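import Mathlib.Analysis.SpecialFunctions.Complex.Arg
import Mathlib.Analysis.SpecialFunctions.Pow.Real
import Literature.Combinatorics.StablePolynomials.Limits
import HarnessLib

/-!
# The support of a polynomial with the half-plane property is a jump system (Brändén 2007, Thm. 3.2)

Topic `Literature/Combinatorics/StablePolynomials`, namespace `Literature.Combinatorics.StablePolynomials`; lane
`lit-hodgefound` (Track 2 foundations library), seat p16, generation 30 (row g30-#1). Companion of `Basic.lean`
(`IsUpperHalfPlaneStable`, `IsRealStable`) and `Limits.lean` (multivariate Hurwitz
`eq_zero_or_isUpperHalfPlaneStable_of_tendsto_coeff`, Gauss–Lucas `IsUpperHalfPlaneStable.pderiv` /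
`.foldr_pderiv`). This is the input "`S^d_n ⊆ M^d_n` [Brändén 2007]" of Brändén–Huh's Definition 2.6 / Prop. 2.2
(`Literature/Combinatorics/LorentzianPolynomials/StableLorentzian.lean` draws the M-convex / matroid / Lorentzian
consequences).

## Source (verbatim) — P. Brändén, *Polynomials with the half-plane property and matroid theory*, Adv. Math. 216
## (2007) 302–320 [Branden2007] (held `paper:arxiv-math_0605678`)

§1: "Let `H ⊂ ℂ` be an open half-plane whose boundary contains the origin. We say that a multivariate polynomial
with complex coefficients is `H`-stable if it is nonzero whenever all the variables are in `H`. […] if `P` is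
`H`-stable for some `H`, then `P` is said to have the half-plane property". §2: "Let `α, β ∈ ℤⁿ` and define
`|α| = Σᵢ |αᵢ|`. The set of steps from `α` to `β` is defined by
`St(α, β) = {σ ∈ ℤⁿ : |σ| = 1, |α + σ - β| = |α - β| - 1}`. A collection `𝓕` of points in `ℤⁿ` is called a
*jump system* if it respects the following axiom. **Two-step Axiom**: If `α, β ∈ 𝓕`, `σ ∈ St(α, β)` and
`α + σ ∉ 𝓕`, then there is a `τ ∈ St(α + σ, β)` such that `α + σ + τ ∈ 𝓕`." "Delta-matroids are precisely the
jump systems for which `𝓕 ⊆ {0,1}ⁿ`". §3, Prop. 3.1: "Let `f ∈ ℂ[z₁, …, zₙ]` be `H`-stable. Then either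
`∂f/∂z₁ = 0` or `∂f/∂z₁` is `H`-stable." "Suppose that […] `α, β ∈ supp(f)` with `α ≤ β`. Let
`g(z) = ∂^{κ-β}[z^κ f(1/z)]` […] `f_{α,β}(z) = ∂^α[z^β g(1/z)]` […] `f_{α,β}` is `H`-stable and
`supp(f_{α,β}) = {γ - α : γ ∈ supp(f) ∩ [α, β]}`." **Theorem 3.2.** "Suppose that `f` has the half-plane
property. Then the support of `f` is a jump system." Proof: "we may assume that `f` is Hurwitz stable. Consider
`α, β ∈ supp(f)`. Let `μ(z)` be the change of variables `zᵢ ↦ zᵢ⁻¹` if `αᵢ > βᵢ`, `zᵢ` otherwise, and let `γ ∈ ℕⁿ`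
be sufficiently large so that `g(z) = z^γ f(μ(z))` is a polynomial. […] it is no restriction in assuming that
`α ≤ β` […]. Suppose that there is a Hurwitz stable polynomial `f` and `α, β ∈ supp(f)` with `α ≤ β` for which
the two-step axiom is violated. Also, let `f` and `α, β` be minimal with respect to `|α - β|`. […] we may assume
that our minimal counterexample is of the form […] `a(0)a(β) ≠ 0` […] and `supp(f) ⊆ [0, β]`. By symmetry we may
assume that `σ = e₁` […]. Then […] `e₁, 2e₁, e₁ + e₂, …, e₁ + eₙ ∉ supp(f)` […]. If there was a
`ξ ∈ (e₁, β) ∩ supp(f)` then there would be a smaller counterexample `f_{0,ξ}`. Hence, if `γ ∈ ℕⁿ` with `γ₁ > 0`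
then `a(γ) = 0` unless `γ = β`. Let `λ > 0` and let `r = (1/β₁) Σ_{i=2}^n βᵢ`. Then the univariate polynomial
`f(λ^{-r} z, λz, …, λz)` is Hurwitz stable. Letting `λ → 0` we end up with the polynomial `a(0) + a(β) z^{|β|}`,
which is then Hurwitz stable by Hurwitz's Theorem […]. We cannot have `|β| ≤ 2`, since then the two-step axiom
would be valid, so `|β| ≥ 3`. This gives a contradiction since, when `n ≥ 3`, at least one of the `n`th roots of
a non-zero complex number is in any given half-plane whose boundary contains the origin." **Corollary 3.3.**
"The support of a multi-affine polynomial with the half-plane property is a delta-matroid." **Corollary 3.7.**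
"Let `f` be a real stable polynomial with nonnegative coefficients. If `α ≤ γ ≤ β` and `α, β ∈ supp(f)`, then
`γ ∈ supp(f)`." Proof: "[…] `α + eᵢ ∉ supp(f)` […]. By the two-step axiom there is a `1 ≤ j ≤ n` such that
`ξ = α + eᵢ + eⱼ ∈ supp(f)`. Now, `f_{α,ξ} = a + b zⱼ + c zᵢzⱼ`, `a, b, c ≥ 0`, `ac > 0` is real stable. If `i = j`
then `f_{α,ξ} = a + c zᵢ²` is not real stable, so we must have `i ≠ j`. […] This is a contradiction."

## The transposition to the tree's convention (the only deviation from the printed text)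

The tree's stable polynomials are the UPPER half-plane ones (`IsUpperHalfPlaneStable`, Borcea–Brändén), for
which `Limits.lean` supplies Hurwitz's theorem and Prop. 3.1. Brändén rotates to Hurwitz (right half-plane)
stability so that the inversion `zᵢ ↦ 1/zᵢ` preserves the half-plane; we stay in the upper half-plane and use
instead `zᵢ ↦ -1/zᵢ`, which maps `{Im z > 0}` onto itself (`Im(-1/z) = Im z/|z|²`). Accordingly the reversal
`z^κ f(1/z)` becomes `flipVars univ κ f = z^κ f(-1/z)` and the change of variables `μ` becomes
`flipVars I κ f = z_I^κ f(…, -1/zᵢ (i ∈ I), …)`; these differ from Brändén's by signs `(-1)^{Σ_{i∈I} mᵢ}` on the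
coefficients, which never affect supports. The half-plane property itself (`HasHalfPlaneProperty`) is reduced
to the upper half-plane by the rotation `z ↦ u⁻¹z` exactly as in the first sentence of the printed proof. The
minimal counterexample is organised as a strong induction on `|β - α|` (`twoStep_of_le`), the induction
hypothesis playing the role of "there would be a smaller counterexample `f_{0,ξ}`"; the final paragraph is
`false_of_normalized` (with the integer weights `zₖ ↦ λ^{-S} z`, `zᵢ ↦ λ^{βₖ} z`, `S = |β| - βₖ`, in place of
`λ^{-r}, λ`, so that only natural powers of `λ` occur). Jump systems are subsets of `ℤⁿ` in [Branden2007]; a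
support lies in `ℕⁿ` and every point the two-step axiom produces lies between two support points, so the axiom is
stated on `σ →₀ ℕ` with the steps written out coordinatewise (`IsStep`: for `α, β ∈ ℕⁿ` the steps from `α` to
`β` are `+eᵢ` for `αᵢ < βᵢ` and `-eᵢ` for `αᵢ > βᵢ`).

## What is here (`σ` a finite type of variables; `p : MvPolynomial σ ℂ`)

* §1 `IsStep α β γ` (`γ = α + s`, `s ∈ St(α, β)`), `IsJumpSystem J` (the two-step axiom), `isStep_iff_of_le`.
* §2 `degVec p` (`κᵢ = deg_{zᵢ} p`), `boxReflect I κ m` (`mᵢ ↦ κᵢ - mᵢ` on `I`), **`flipVars I κ p`**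
  (`z_I^κ · p(-1/z_I)`): `coeff_boxReflect_flipVars`, `coeff_flipVars_ne_zero_iff`, `eval_flipVars`,
  `IsUpperHalfPlaneStable.flipVars`; `IsStep.boxReflect` (reflections carry steps to steps).
* §3 `lowerCut ν p = ∂^ν p` (as an iterated `pderiv`, the form of `Limits.foldr_pderiv`): `coeff_lowerCut`
  (`coeff_m ∂^ν p = c · coeff_{m+ν} p`, `c ∈ ℕ_{>0}`); §4 `upperCut`, **`boxCut lo hi p`** = Brändén's `f_{lo,hi}`:
  `coeff_boxCut` / `coeff_boxCut_ne_zero_iff` (`supp f_{α,β} = {γ - α : γ ∈ supp f ∩ [α, β]}`, all surviving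
  coefficients multiplied by positive integers and ONE common sign), `IsUpperHalfPlaneStable.boxCut`.
* §5 `exists_im_pos_pow_eq` ("one of the `N`th roots lies in the half-plane", `N ≥ 3`) and
  **`false_of_normalized`** (the last paragraph of the proof). §6 **`IsUpperHalfPlaneStable.twoStep_of_le`**
  (the two-step axiom for `α ≤ β`, strong induction on `|β - α|`). §7 **Theorem 3.2**:
  `IsUpperHalfPlaneStable.isJumpSystem_support`, `IsRealStable.isJumpSystem_support`, `HasHalfPlaneProperty`,
  **`HasHalfPlaneProperty.isJumpSystem_support`** (as printed; Cor. 3.3 is the case of supports in `{0,1}ⁿ`).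
* §8 **Corollary 3.7** `IsRealStable.coeff_ne_zero_of_le_of_le` (no internal zeros for real stable polynomials
  with nonnegative coefficients), through `IsRealStable.coeff_add_single_ne_zero` (one step up inside `[α, β]`).

Definitions carry bodies; theorems only otherwise (no named fact, no `sorry`; net debt 0).

## References

* [Branden2007] P. Brändén, *Polynomials with the half-plane property and matroid theory*, Adv. Math. 216 (2007)
  302–320, arXiv:math/0605678 — §2 (jump systems, two-step axiom), §3 Prop. 3.1, Thm. 3.2 and its proof,
  Cor. 3.3, Cor. 3.4, Cor. 3.7.
* [ChoeOxleySokalWagner2004] Y.-B. Choe, J. G. Oxley, A. D. Sokal, D. G. Wagner, *Homogeneous multivariate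
  polynomials with the half-plane property*, Adv. Appl. Math. 32 (2004) 88–187 — Thm. 7.1 (the homogeneous
  multi-affine case), the origin of Brändén's Cor. 3.4.
* [Wagner2011] D. G. Wagner, *Multivariate stable polynomials*, Bull. AMS 48 (2011) — §2 (Hurwitz's theorem,
  Lemma 2.4), as used through `Limits.lean`.
* [BrandenHuh2019] P. Brändén, J. Huh, *Lorentzian polynomials*, Ann. of Math. 192 (2020) — §2.2 ("It follows from
  [Brändén 2007] that `S^d_n ⊆ M^d_n`"), the consumer of this file.
-/

noncomputable section

open scoped BigOperators Topology
open MvPolynomial Filter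

namespace Literature.Combinatorics.StablePolynomials

variable {σ : Type*}

/-! ## §1 Steps and jump systems (Bouchet–Cunningham; Brändén 2007, §2) -/

section Steps

/-- **A step from `α` towards `β`** lands at `γ`: "`St(α, β) = {σ ∈ ℤⁿ : |σ| = 1, |α + σ - β| = |α - β| - 1}`",
written out for `α, β ∈ ℕⁿ` — `γ = α + eᵢ` for a coordinate with `αᵢ < βᵢ`, or `γ = α - eᵢ` for a coordinate
with `αᵢ > βᵢ`. [cite: Branden2007, §2 (the set of steps `St(α, β)`)] -/
def IsStep (α β γ : σ →₀ ℕ) : Prop :=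
  ∃ i, (α i < β i ∧ γ = α + Finsupp.single i 1) ∨ (β i < α i ∧ α = γ + Finsupp.single i 1)

/-- **Jump system** (Bouchet–Cunningham), by the "Two-step Axiom: If `α, β ∈ 𝓕`, `σ ∈ St(α, β)` and
`α + σ ∉ 𝓕`, then there is a `τ ∈ St(α + σ, β)` such that `α + σ + τ ∈ 𝓕`" — for a set of exponent vectors
`J ⊆ ℕⁿ` (every point the axiom mentions lies between `α` and `β`, so nothing is lost by staying in `ℕⁿ`).
"Delta-matroids are precisely the jump systems for which `𝓕 ⊆ {0,1}ⁿ`." [cite: Branden2007, §2 (Two-step Axiom)] -/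
def IsJumpSystem (J : Set (σ →₀ ℕ)) : Prop :=
  ∀ ⦃α β γ : σ →₀ ℕ⦄, α ∈ J → β ∈ J → IsStep α β γ → γ ∉ J → ∃ δ, IsStep γ β δ ∧ δ ∈ J

/-- `α + eᵢ` is a step from `α` towards `β` when `αᵢ < βᵢ`. [cite: Branden2007, §2] -/
theorem isStep_add_single {α β : σ →₀ ℕ} {i : σ} (h : α i < β i) :
    IsStep α β (α + Finsupp.single i 1) :=
  ⟨i, Or.inl ⟨h, rfl⟩⟩

/-- `γ` with `γ + eᵢ = α` is a step from `α` towards `β` when `βᵢ < αᵢ`. [cite: Branden2007, §2] -/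
theorem isStep_of_eq_add_single {α β γ : σ →₀ ℕ} {i : σ} (h : β i < α i) (hγ : α = γ + Finsupp.single i 1) :
    IsStep α β γ :=
  ⟨i, Or.inr ⟨h, hγ⟩⟩

/-- When `α ≤ β` the steps from `α` towards `β` are exactly the points `α + eᵢ` with `αᵢ < βᵢ` (the case
"`α ≤ β`" to which the printed proof reduces). [cite: Branden2007, §3 proof of Thm. 3.2 ("it is no restriction in
assuming that `α ≤ β`")] -/
theorem isStep_iff_of_le {α β γ : σ →₀ ℕ} (hle : α ≤ β) :
    IsStep α β γ ↔ ∃ i, α i < β i ∧ γ = α + Finsupp.single i 1 := by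
  constructor
  · rintro ⟨i, h | h⟩
    · exact ⟨i, h⟩
    · exact absurd (Finsupp.le_def.1 hle i) (not_le.2 h.1)
  · rintro ⟨i, h⟩
    exact ⟨i, Or.inl h⟩

/-- A step from `α` towards `β` stays between `α` and `β` coordinatewise (upper bound).
[cite: Branden2007, §2] -/
theorem IsStep.apply_le_max {α β γ : σ →₀ ℕ} (h : IsStep α β γ) (j : σ) : γ j ≤ max (α j) (β j) := by
  classical
  obtain ⟨i, ⟨hlt, rfl⟩ | ⟨_, rfl⟩⟩ := h
  · rw [Finsupp.add_apply, Finsupp.single_apply]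
    split_ifs with hij
    · subst hij
      exact le_max_of_le_right (Nat.succ_le_of_lt hlt)
    · rw [add_zero]
      exact le_max_left _ _
  · rw [Finsupp.add_apply]
    exact le_max_of_le_left (Nat.le_add_right _ _)

/-- `|a| < |b|` for `a < b` in `ℕⁿ`. [folklore] -/
private theorem degree_lt_degree_of_lt {a b : σ →₀ ℕ} (h : a < b) : a.degree < b.degree := by
  obtain ⟨c, rfl⟩ := exists_add_of_le h.le
  have hc : c ≠ 0 := by
    rintro rfl
    simp at h
  rw [map_add]
  have : 0 < c.degree := Nat.pos_of_ne_zero fun h0 => hc ((Finsupp.degree_eq_zero_iff c).1 h0)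
  omega

/-- A vector of degree one is a unit vector. [folklore] -/
private theorem exists_eq_single_of_degree_eq_one {ν : σ →₀ ℕ} (h : ν.degree = 1) :
    ∃ j, ν = Finsupp.single j 1 := by
  have hν : ν ≠ 0 := by
    intro h0
    rw [h0, map_zero] at h
    exact zero_ne_one h
  obtain ⟨j, hj⟩ : ∃ j, ν j ≠ 0 := by
    simpa using DFunLike.ne_iff.1 hν
  refine ⟨j, ?_⟩
  have hsplit : ν - Finsupp.single j 1 + Finsupp.single j 1 = ν := Finsupp.sub_add_single_one_cancel hj
  have hdeg : (ν - Finsupp.single j 1).degree = 0 := by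
    have := congrArg Finsupp.degree hsplit
    rw [map_add, Finsupp.degree_single, h] at this
    omega
  rw [(Finsupp.degree_eq_zero_iff _).1 hdeg, zero_add] at hsplit
  exact hsplit.symm

end Steps

/-! ## §2 The degree vector, box reflections and the flips `z_I^κ · p(-1/z_I)` -/

section DegVec

variable [Fintype σ]

/-- The vector `κ = (deg_{z₁} p, …, deg_{zₙ} p)` of partial degrees ("`f` […] of degree `κᵢ` in each variable").
[cite: Branden2007, §3 (before Thm. 3.2)] -/
def degVec {R : Type*} [CommSemiring R] (p : MvPolynomial σ R) : σ →₀ ℕ :=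
  Finsupp.equivFunOnFinite.symm fun i => p.degreeOf i

/-- `κᵢ = deg_{zᵢ} p`. [cite: Branden2007, §3 (before Thm. 3.2, "of degree `κᵢ` in each variable")] -/
@[simp]
theorem degVec_apply {R : Type*} [CommSemiring R] (p : MvPolynomial σ R) (i : σ) :
    degVec p i = p.degreeOf i := by
  simp [degVec]

/-- Every exponent vector of `p` lies in the box `[0, κ]`. [cite: Branden2007, §3 ("`f(z) = Σ_{0 ≤ γ ≤ κ} a(γ) z^γ`")] -/
theorem le_degVec {R : Type*} [CommSemiring R] {p : MvPolynomial σ R} {m : σ →₀ ℕ} (hm : coeff m p ≠ 0) :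
    m ≤ degVec p :=
  Finsupp.le_def.2 fun i => by
    rw [degVec_apply]
    exact monomial_le_degreeOf i (mem_support_iff.2 hm)

/-- `p` lives in its own box `[0, κ]`. [cite: Branden2007, §3] -/
theorem fits_degVec {R : Type*} [CommSemiring R] (p : MvPolynomial σ R) (I : Finset σ) :
    ∀ m ∈ p.support, ∀ i ∈ I, m i ≤ degVec p i :=
  fun _ hm i _ => Finsupp.le_def.1 (le_degVec (mem_support_iff.1 hm)) i

end DegVec

/-- `(-1)^k ≠ 0` in `ℂ`. [folklore] -/
private theorem neg_one_pow_ne_zero' (k : ℕ) : ((-1 : ℂ) ^ k) ≠ 0 := pow_ne_zero _ (by norm_num)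

section Flip

variable [Fintype σ] [DecidableEq σ]

/-- Reflection of the box `[0, κ]` in the coordinates `I`: `mᵢ ↦ κᵢ - mᵢ` for `i ∈ I`, `mᵢ ↦ mᵢ` otherwise
(the exponent bookkeeping of `zᵢ ↦ zᵢ⁻¹`, `i ∈ I`, followed by multiplication with `z_I^κ`).
[cite: Branden2007, §3 proof of Thm. 3.2 (the change of variables `μ`)] -/
def boxReflect (I : Finset σ) (κ m : σ →₀ ℕ) : σ →₀ ℕ :=
  Finsupp.equivFunOnFinite.symm fun i => if i ∈ I then κ i - m i else m i

/-- The coordinates of a reflected exponent vector. [cite: Branden2007, §3 proof of Thm. 3.2 (the change of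
variables `μ`: "`α, β ∈ supp(f)` are translated to `α', β' ∈ supp(g)`")] -/
@[simp]
theorem boxReflect_apply (I : Finset σ) (κ m : σ →₀ ℕ) (i : σ) :
    boxReflect I κ m i = if i ∈ I then κ i - m i else m i := by
  simp [boxReflect]

/-- The reflected vector lies in the box on `I`. [cite: Branden2007, §3 proof of Thm. 3.2] -/
theorem boxReflect_fits (I : Finset σ) (κ m : σ →₀ ℕ) : ∀ i ∈ I, boxReflect I κ m i ≤ κ i := by
  intro i hi
  rw [boxReflect_apply, if_pos hi]
  exact Nat.sub_le _ _

/-- The reflection is an involution on the box. [cite: Branden2007, §3 proof of Thm. 3.2] -/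
theorem boxReflect_boxReflect {I : Finset σ} {κ m : σ →₀ ℕ} (h : ∀ i ∈ I, m i ≤ κ i) :
    boxReflect I κ (boxReflect I κ m) = m := by
  ext i
  by_cases hi : i ∈ I
  · rw [boxReflect_apply, if_pos hi, boxReflect_apply, if_pos hi, Nat.sub_sub_self (h i hi)]
  · rw [boxReflect_apply, if_neg hi, boxReflect_apply, if_neg hi]

/-- The reflection is injective on the box. [cite: Branden2007, §3 proof of Thm. 3.2] -/
theorem boxReflect_injOn {I : Finset σ} {κ m n : σ →₀ ℕ} (hm : ∀ i ∈ I, m i ≤ κ i) (hn : ∀ i ∈ I, n i ≤ κ i)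
    (h : boxReflect I κ m = boxReflect I κ n) : m = n := by
  rw [← boxReflect_boxReflect hm, h, boxReflect_boxReflect hn]

/-- Reflecting commutes with a unit step in a coordinate outside `I`. [cite: Branden2007, §3 proof of Thm. 3.2] -/
theorem boxReflect_add_single_of_not_mem {I : Finset σ} {κ : σ →₀ ℕ} (m : σ →₀ ℕ) {i : σ} (hi : i ∉ I) :
    boxReflect I κ (m + Finsupp.single i 1) = boxReflect I κ m + Finsupp.single i 1 := by
  ext j
  rw [Finsupp.add_apply, boxReflect_apply, boxReflect_apply, Finsupp.add_apply, Finsupp.single_apply]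
  by_cases hj : j ∈ I
  · have hij : i ≠ j := fun h => hi (h ▸ hj)
    rw [if_pos hj, if_pos hj, if_neg hij, add_zero, add_zero]
  · rw [if_neg hj, if_neg hj]

/-- Reflecting turns a unit step up in a coordinate of `I` into a unit step down.
[cite: Branden2007, §3 proof of Thm. 3.2] -/
theorem boxReflect_add_single_of_mem {I : Finset σ} {κ : σ →₀ ℕ} (m : σ →₀ ℕ) {i : σ} (hi : i ∈ I)
    (h : m i + 1 ≤ κ i) :
    boxReflect I κ m = boxReflect I κ (m + Finsupp.single i 1) + Finsupp.single i 1 := by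
  ext j
  rw [Finsupp.add_apply, boxReflect_apply, boxReflect_apply, Finsupp.add_apply, Finsupp.single_apply]
  by_cases hj : j ∈ I
  · rw [if_pos hj, if_pos hj]
    by_cases hij : i = j
    · subst hij
      rw [if_pos rfl]
      omega
    · rw [if_neg hij, add_zero, add_zero]
  · have hij : i ≠ j := fun h' => hj (h' ▸ hi)
    rw [if_neg hj, if_neg hj, if_neg hij, add_zero, add_zero]

/-- **Steps are carried to steps by a box reflection** (this is why "it is no restriction in assuming that
`α ≤ β`, when checking the validity of the two-step axiom"). [cite: Branden2007, §3 proof of Thm. 3.2] -/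
theorem IsStep.boxReflect {I : Finset σ} {κ α β γ : σ →₀ ℕ} (hα : ∀ i ∈ I, α i ≤ κ i)
    (hβ : ∀ i ∈ I, β i ≤ κ i) (hγ : ∀ i ∈ I, γ i ≤ κ i) (h : IsStep α β γ) :
    IsStep (boxReflect I κ α) (boxReflect I κ β) (boxReflect I κ γ) := by
  obtain ⟨i, ⟨hlt, rfl⟩ | ⟨hlt, rfl⟩⟩ := h
  · by_cases hi : i ∈ I
    · refine ⟨i, Or.inr ⟨?_, boxReflect_add_single_of_mem α hi ?_⟩⟩
      · rw [boxReflect_apply, if_pos hi, boxReflect_apply, if_pos hi]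
        have := hβ i hi
        omega
      · have := hγ i hi
        rwa [Finsupp.add_apply, Finsupp.single_eq_same] at this
    · refine ⟨i, Or.inl ⟨?_, boxReflect_add_single_of_not_mem α hi⟩⟩
      rwa [boxReflect_apply, if_neg hi, boxReflect_apply, if_neg hi]
  · by_cases hi : i ∈ I
    · refine ⟨i, Or.inl ⟨?_, boxReflect_add_single_of_mem γ hi ?_⟩⟩
      · rw [boxReflect_apply, if_pos hi, boxReflect_apply, if_pos hi, Finsupp.add_apply,
          Finsupp.single_eq_same]
        have := hα i hi
        rw [Finsupp.add_apply, Finsupp.single_eq_same] at this hlt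
        omega
      · have := hα i hi
        rwa [Finsupp.add_apply, Finsupp.single_eq_same] at this
    · refine ⟨i, Or.inr ⟨?_, boxReflect_add_single_of_not_mem γ hi⟩⟩
      rw [boxReflect_apply, if_neg hi, boxReflect_apply, if_neg hi, Finsupp.add_apply]
      rwa [Finsupp.add_apply] at hlt

/-- **The flip `z_I^κ · p(…, -1/zᵢ (i ∈ I), …)`**: the polynomial whose coefficient at the reflected exponent
`boxReflect I κ m` is `(-1)^{Σ_{i∈I} mᵢ} coeff_m p` — Brändén's `z^γ f(μ(z))` (for `I` the set of coordinates
to invert) and `z^κ f(1/z)` (for `I = [n]`), with `1/zᵢ` replaced by `-1/zᵢ` so as to stay in the upper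
half-plane. [cite: Branden2007, §3 (the polynomials `z^κ f(1/z)`, `z^γ f(μ(z))`)] -/
def flipVars (I : Finset σ) (κ : σ →₀ ℕ) (p : MvPolynomial σ ℂ) : MvPolynomial σ ℂ :=
  ∑ m ∈ p.support, monomial (boxReflect I κ m) ((-1) ^ (∑ i ∈ I, m i) * coeff m p)

/-- The coefficients of a flip, as a sum over the support. [cite: Branden2007, §3] -/
theorem coeff_flipVars (I : Finset σ) (κ : σ →₀ ℕ) (p : MvPolynomial σ ℂ) (n : σ →₀ ℕ) :
    coeff n (flipVars I κ p) =
      ∑ m ∈ p.support, if boxReflect I κ m = n then (-1) ^ (∑ i ∈ I, m i) * coeff m p else 0 := by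
  simp only [flipVars, coeff_sum, coeff_monomial]

/-- Outside the box the flip has no coefficients. [cite: Branden2007, §3] -/
theorem coeff_flipVars_of_not_fits {I : Finset σ} {κ : σ →₀ ℕ} (p : MvPolynomial σ ℂ) {n : σ →₀ ℕ}
    (hn : ¬ ∀ i ∈ I, n i ≤ κ i) : coeff n (flipVars I κ p) = 0 := by
  rw [coeff_flipVars]
  refine Finset.sum_eq_zero fun m _ => ?_
  rw [if_neg]
  rintro rfl
  exact hn (boxReflect_fits I κ m)

/-- The support of a flip lies in the box on `I`. [cite: Branden2007, §3] -/
theorem flipVars_fits (I : Finset σ) (κ : σ →₀ ℕ) (p : MvPolynomial σ ℂ) :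
    ∀ n ∈ (flipVars I κ p).support, ∀ i ∈ I, n i ≤ κ i := by
  intro n hn
  by_contra h
  exact (mem_support_iff.1 hn) (coeff_flipVars_of_not_fits p h)

/-- **The coefficient of `z^κ f(-1/z)` type flips**: at the reflected exponent the coefficient is
`(-1)^{Σ_{i∈I} nᵢ} coeff_n p`, provided `p` lives in the box (`deg_{zᵢ} p ≤ κᵢ` on `I`).
[cite: Branden2007, §3 ("`supp(f_{α,β}) = {γ - α : γ ∈ supp(f) ∩ [α, β]}`", the bookkeeping of supports under
reversal)] -/
theorem coeff_boxReflect_flipVars {I : Finset σ} {κ : σ →₀ ℕ} {p : MvPolynomial σ ℂ}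
    (hp : ∀ m ∈ p.support, ∀ i ∈ I, m i ≤ κ i) {n : σ →₀ ℕ} (hn : ∀ i ∈ I, n i ≤ κ i) :
    coeff (boxReflect I κ n) (flipVars I κ p) = (-1) ^ (∑ i ∈ I, n i) * coeff n p := by
  rw [coeff_flipVars, Finset.sum_eq_single n]
  · rw [if_pos rfl]
  · intro m hm hmn
    rw [if_neg]
    intro h
    exact hmn (boxReflect_injOn (hp m hm) hn h)
  · intro hn'
    rw [if_pos rfl, notMem_support_iff.1 hn', mul_zero]

/-- The coefficient of a flip at an exponent of the box. [cite: Branden2007, §3] -/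
theorem coeff_flipVars_of_fits {I : Finset σ} {κ : σ →₀ ℕ} {p : MvPolynomial σ ℂ}
    (hp : ∀ m ∈ p.support, ∀ i ∈ I, m i ≤ κ i) {n : σ →₀ ℕ} (hn : ∀ i ∈ I, n i ≤ κ i) :
    coeff n (flipVars I κ p) = (-1) ^ (∑ i ∈ I, boxReflect I κ n i) * coeff (boxReflect I κ n) p := by
  have := coeff_boxReflect_flipVars hp (boxReflect_fits I κ n)
  rwa [boxReflect_boxReflect hn] at this

/-- **The support of a flip is the reflected support.** [cite: Branden2007, §3 proof of Thm. 3.2 ("`α, β ∈ supp(f)`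
are translated to `α', β' ∈ supp(g)`")] -/
theorem coeff_flipVars_ne_zero_iff {I : Finset σ} {κ : σ →₀ ℕ} {p : MvPolynomial σ ℂ}
    (hp : ∀ m ∈ p.support, ∀ i ∈ I, m i ≤ κ i) {n : σ →₀ ℕ} :
    coeff n (flipVars I κ p) ≠ 0 ↔ (∀ i ∈ I, n i ≤ κ i) ∧ coeff (boxReflect I κ n) p ≠ 0 := by
  by_cases hn : ∀ i ∈ I, n i ≤ κ i
  · rw [coeff_flipVars_of_fits hp hn]
    exact ⟨fun h => ⟨hn, (mul_ne_zero_iff.1 h).2⟩, fun h => mul_ne_zero (neg_one_pow_ne_zero' _) h.2⟩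
  · simp only [coeff_flipVars_of_not_fits p hn, ne_eq, not_true_eq_false, hn, false_and]

/-- The flip of the zero polynomial is zero. [folklore] -/
private theorem flipVars_zero (I : Finset σ) (κ : σ →₀ ℕ) : flipVars I κ (0 : MvPolynomial σ ℂ) = 0 := by
  simp [flipVars]

/-- **Evaluation of a flip**: `(flipVars I κ p)(z) = (∏_{i∈I} zᵢ^{κᵢ}) · p(w)` with `wᵢ = -1/zᵢ` for `i ∈ I`
and `wᵢ = zᵢ` otherwise (`zᵢ ≠ 0` on `I`). [cite: Branden2007, §3 proof of Thm. 3.2 ("`g(z) = z^γ f(μ(z))`")] -/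
theorem eval_flipVars {I : Finset σ} {κ : σ →₀ ℕ} {p : MvPolynomial σ ℂ}
    (hp : ∀ m ∈ p.support, ∀ i ∈ I, m i ≤ κ i) (z : σ → ℂ) (hz : ∀ i ∈ I, z i ≠ 0) :
    eval z (flipVars I κ p) =
      (∏ i ∈ I, z i ^ κ i) * eval (fun i => if i ∈ I then -(z i)⁻¹ else z i) p := by
  rw [flipVars, map_sum, MvPolynomial.eval_eq' (fun i => if i ∈ I then -(z i)⁻¹ else z i) p,
    Finset.mul_sum]
  refine Finset.sum_congr rfl fun m hm => ?_
  rw [eval_monomial, Finsupp.prod_fintype _ _ (fun i => by rw [pow_zero])]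
  simp only [boxReflect_apply]
  rw [← Finset.prod_mul_prod_compl I (fun i => z i ^ (if i ∈ I then κ i - m i else m i)),
    ← Finset.prod_mul_prod_compl I (fun i => (if i ∈ I then -(z i)⁻¹ else z i) ^ m i)]
  have h1 : ∏ i ∈ I, z i ^ (if i ∈ I then κ i - m i else m i) = ∏ i ∈ I, z i ^ (κ i - m i) :=
    Finset.prod_congr rfl fun i hi => by rw [if_pos hi]
  have h2 : ∏ i ∈ Iᶜ, z i ^ (if i ∈ I then κ i - m i else m i) = ∏ i ∈ Iᶜ, z i ^ m i :=
    Finset.prod_congr rfl fun i hi => by rw [if_neg (Finset.mem_compl.1 hi)]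
  have h3 : ∏ i ∈ I, (if i ∈ I then -(z i)⁻¹ else z i) ^ m i =
      ∏ i ∈ I, ((-1) ^ m i * (z i ^ m i)⁻¹) :=
    Finset.prod_congr rfl fun i hi => by rw [if_pos hi, neg_eq_neg_one_mul, mul_pow, inv_pow]
  have h4 : ∏ i ∈ Iᶜ, (if i ∈ I then -(z i)⁻¹ else z i) ^ m i = ∏ i ∈ Iᶜ, z i ^ m i :=
    Finset.prod_congr rfl fun i hi => by rw [if_neg (Finset.mem_compl.1 hi)]
  have h5 : ∏ i ∈ I, z i ^ (κ i - m i) = (∏ i ∈ I, z i ^ κ i) * ∏ i ∈ I, (z i ^ m i)⁻¹ := by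
    rw [← Finset.prod_mul_distrib]
    refine Finset.prod_congr rfl fun i hi => ?_
    rw [pow_sub₀ _ (hz i hi) (hp m hm i hi)]
  rw [h1, h2, h3, h4, h5, Finset.prod_mul_distrib, Finset.prod_pow_eq_pow_sum]
  ring

/-- **Flips preserve stability**: `-1/z` lies in the upper half-plane when `z` does (`Im(-1/z) = Im z/|z|²`),
and `z_I^κ ≠ 0` there — the upper half-plane form of "Clearly `f(z)` is Hurwitz stable if and only if `g(z)` is"
and "`z^κ f(1/z)` is `H̄`-stable". [cite: Branden2007, §3 (before Thm. 3.2, and proof of Thm. 3.2)] -/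
theorem IsUpperHalfPlaneStable.flipVars {I : Finset σ} {κ : σ →₀ ℕ} {p : MvPolynomial σ ℂ}
    (hst : IsUpperHalfPlaneStable p) (hp : ∀ m ∈ p.support, ∀ i ∈ I, m i ≤ κ i) :
    IsUpperHalfPlaneStable (flipVars I κ p) := by
  intro z hz
  have hz0 : ∀ i ∈ I, z i ≠ 0 := fun i _ h => (hz i).ne' (by rw [h, Complex.zero_im])
  rw [eval_flipVars hp z hz0]
  refine mul_ne_zero (Finset.prod_ne_zero_iff.2 fun i hi => pow_ne_zero _ (hz0 i hi)) (hst _ fun i => ?_)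
  by_cases hi : i ∈ I
  · simp only [if_pos hi, Complex.neg_im, Complex.inv_im, neg_div, neg_neg]
    exact div_pos (hz i) (Complex.normSq_pos.2 (hz0 i hi))
  · simp only [if_neg hi]
    exact hz i

end Flip

/-! ## §3 The lower cut `∂^ν` -/

section LowerCut

/-- **`∂^ν p`**, as the iterated partial derivative `∂_{i₁} ⋯ ∂_{i_{|ν|}} p` along the list of coordinates of `ν`
(with multiplicity; the order is immaterial for everything below) — the form in which `Limits.foldr_pderiv`
states Prop. 3.1 for mixed derivatives. Brändén's `∂^α` in `f_{α,β} = ∂^α[z^β g(1/z)]`.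
[cite: Branden2007, §3 ("`∂^α f = ∂^{α₁}/∂z₁^{α₁} ⋯ ∂^{αₙ}/∂zₙ^{αₙ} f`")] -/
def lowerCut (ν : σ →₀ ℕ) (p : MvPolynomial σ ℂ) : MvPolynomial σ ℂ :=
  (Finsupp.toMultiset ν).toList.foldr (fun i q => pderiv i q) p

/-- Coefficients of an iterated partial derivative: `coeff_m (∂_{i₁}⋯∂_{i_r} p) = c · coeff_{m + Σ e_{i_t}} p` with
a positive integer `c`. [cite: Branden2007, §3 (supports of derivatives, before Thm. 3.2)] -/
theorem coeff_foldr_pderiv (l : List σ) (p : MvPolynomial σ ℂ) (m : σ →₀ ℕ) :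
    ∃ c : ℕ, 0 < c ∧ coeff m (l.foldr (fun i q => pderiv i q) p) =
      c * coeff (m + (l.map fun i => Finsupp.single i 1).sum) p := by
  induction l generalizing m with
  | nil => exact ⟨1, one_pos, by simp⟩
  | cons i l ih =>
    obtain ⟨c, hc, h⟩ := ih (m + Finsupp.single i 1)
    refine ⟨(m i + 1) * c, by positivity, ?_⟩
    rw [List.foldr_cons, coeff_pderiv, h, List.map_cons, List.sum_cons, ← add_assoc]
    push_cast
    ring

/-- The iterated derivative of `0` is `0`. [folklore] -/
private theorem foldr_pderiv_zero (l : List σ) :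
    l.foldr (fun i q => pderiv i q) (0 : MvPolynomial σ ℂ) = 0 := by
  induction l with
  | nil => rfl
  | cons i l ih => rw [List.foldr_cons, ih, map_zero]

/-- The unit vectors along the coordinate list of `ν` add up to `ν`. [folklore] -/
private theorem sum_map_single_toList (ν : σ →₀ ℕ) :
    ((Finsupp.toMultiset ν).toList.map fun i => Finsupp.single i 1).sum = ν := by
  rw [← Multiset.sum_coe, ← Multiset.map_coe, Multiset.coe_toList]
  induction ν using Finsupp.induction with
  | zero => simp
  | single_add a b f _ _ ih =>
    rw [map_add, Multiset.map_add, Multiset.sum_add, ih, Finsupp.toMultiset_single, Multiset.map_nsmul,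
      Multiset.sum_nsmul, Multiset.map_singleton, Multiset.sum_singleton, Finsupp.smul_single, smul_eq_mul,
      mul_one]

/-- **Coefficients of `∂^ν p`**: `coeff_m (∂^ν p) = c · coeff_{m+ν} p` for a positive integer `c` (so
`supp ∂^ν p = {γ - ν : γ ∈ supp p, γ ≥ ν}`). [cite: Branden2007, §3 (before Thm. 3.2)] -/
theorem coeff_lowerCut (ν : σ →₀ ℕ) (p : MvPolynomial σ ℂ) (m : σ →₀ ℕ) :
    ∃ c : ℕ, 0 < c ∧ coeff m (lowerCut ν p) = c * coeff (m + ν) p := by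
  obtain ⟨c, hc, h⟩ := coeff_foldr_pderiv (Finsupp.toMultiset ν).toList p m
  rw [sum_map_single_toList] at h
  exact ⟨c, hc, h⟩

/-- `supp ∂^ν p = {γ - ν : γ ∈ supp p, γ ≥ ν}`. [cite: Branden2007, §3 (before Thm. 3.2)] -/
theorem coeff_lowerCut_ne_zero_iff (ν : σ →₀ ℕ) (p : MvPolynomial σ ℂ) (m : σ →₀ ℕ) :
    coeff m (lowerCut ν p) ≠ 0 ↔ coeff (m + ν) p ≠ 0 := by
  obtain ⟨c, hc, h⟩ := coeff_lowerCut ν p m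
  rw [h, mul_ne_zero_iff]
  simp only [ne_eq, Nat.cast_eq_zero, hc.ne', not_false_eq_true, true_and]

/-- `∂^ν 0 = 0`. [folklore] -/
private theorem lowerCut_zero (ν : σ →₀ ℕ) : lowerCut ν (0 : MvPolynomial σ ℂ) = 0 :=
  foldr_pderiv_zero _

/-- **`∂^ν` preserves stability** (Prop. 3.1 iterated): `∂^ν p` is `0` or stable.
[cite: Branden2007, §3 Prop. 3.1] -/
theorem IsUpperHalfPlaneStable.lowerCut_eq_zero_or [Fintype σ] [DecidableEq σ] {p : MvPolynomial σ ℂ}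
    (hp : IsUpperHalfPlaneStable p) (ν : σ →₀ ℕ) :
    lowerCut ν p = 0 ∨ IsUpperHalfPlaneStable (lowerCut ν p) :=
  hp.foldr_pderiv _

end LowerCut

/-! ## §4 The upper cut and Brändén's `f_{α,β}` (the box cut) -/

section BoxCut

variable [Fintype σ] [DecidableEq σ]

/-- **The upper cut at `hi`** (`hi ≤ κ = degVec p`): `z^{hi} · [∂^{κ-hi}(z^κ p(-1/z))](-1/z)` — Brändén's
`z^β g(1/z)` with `g = ∂^{κ-β}[z^κ f(1/z)]`; it keeps exactly the monomials `m ≤ hi`.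
[cite: Branden2007, §3 (the polynomials `g` and `z^β g(1/z)`)] -/
def upperCut (hi : σ →₀ ℕ) (p : MvPolynomial σ ℂ) : MvPolynomial σ ℂ :=
  flipVars Finset.univ hi (lowerCut (degVec p - hi) (flipVars Finset.univ (degVec p) p))

/-- **Brändén's `f_{lo,hi}`** ("`f_{α,β}(z) = ∂^α[z^β g(1/z)]`"): the lower cut at `lo` of the upper cut at
`hi ⊓ κ`. [cite: Branden2007, §3 (definition of `f_{α,β}`)] -/
def boxCut (lo hi : σ →₀ ℕ) (p : MvPolynomial σ ℂ) : MvPolynomial σ ℂ :=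
  lowerCut lo (upperCut (hi ⊓ degVec p) p)

/-- **Coefficients of the upper cut** (`hi ≤ κ`): zero above `hi`, and `(-1)^{|hi|} c · coeff_m p` with a positive
integer `c` for `m ≤ hi`. [cite: Branden2007, §3 ("`supp(f_{α,β}) = {γ - α : γ ∈ supp(f) ∩ [α, β]}`")] -/
theorem coeff_upperCut {p : MvPolynomial σ ℂ} {hi : σ →₀ ℕ} (hhi : hi ≤ degVec p) (m : σ →₀ ℕ) :
    (¬ m ≤ hi → coeff m (upperCut hi p) = 0) ∧
      (m ≤ hi → ∃ c : ℕ, 0 < c ∧ coeff m (upperCut hi p) = (-1) ^ hi.degree * (c * coeff m p)) := by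
  set κ := degVec p with hκ
  have hfit1 : ∀ m ∈ p.support, ∀ i ∈ (Finset.univ : Finset σ), m i ≤ κ i := fits_degVec p _
  set q1 := flipVars Finset.univ κ p with hq1
  set q2 := lowerCut (κ - hi) q1 with hq2
  have hfit2 : ∀ n ∈ q2.support, ∀ i ∈ (Finset.univ : Finset σ), n i ≤ hi i := by
    intro n hn i _
    have h1 := (coeff_lowerCut_ne_zero_iff (κ - hi) q1 n).1 (mem_support_iff.1 hn)
    have h2 := flipVars_fits Finset.univ κ p _ (mem_support_iff.2 h1) i (Finset.mem_univ i)
    have h3 := Finsupp.le_def.1 hhi i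
    simp only [Finsupp.add_apply, Finsupp.tsub_apply] at h2
    omega
  constructor
  · intro hm
    refine coeff_flipVars_of_not_fits q2 fun h => hm (Finsupp.le_def.2 fun i => h i (Finset.mem_univ i))
  · intro hm
    have hmfit : ∀ i ∈ (Finset.univ : Finset σ), m i ≤ hi i := fun i _ => Finsupp.le_def.1 hm i
    obtain ⟨c, hc, hcq⟩ := coeff_lowerCut (κ - hi) q1 (boxReflect Finset.univ hi m)
    have hidx : boxReflect Finset.univ hi m + (κ - hi) = boxReflect Finset.univ κ m := by
      ext i
      simp only [Finsupp.add_apply, Finsupp.tsub_apply, boxReflect_apply, if_pos (Finset.mem_univ i)]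
      have h1 := Finsupp.le_def.1 hm i
      have h2 := Finsupp.le_def.1 hhi i
      omega
    have hmκ : ∀ i ∈ (Finset.univ : Finset σ), m i ≤ κ i :=
      fun i _ => (Finsupp.le_def.1 hm i).trans (Finsupp.le_def.1 hhi i)
    refine ⟨c, hc, ?_⟩
    rw [upperCut, ← hκ, ← hq1, ← hq2, coeff_flipVars_of_fits hfit2 hmfit, hcq, hidx,
      coeff_boxReflect_flipVars hfit1 hmκ]
    have hsum : (∑ i ∈ (Finset.univ : Finset σ), boxReflect Finset.univ hi m i) +
        ∑ i ∈ (Finset.univ : Finset σ), m i = hi.degree := by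
      rw [Finsupp.degree_eq_sum, ← Finset.sum_add_distrib]
      refine Finset.sum_congr rfl fun i _ => ?_
      rw [boxReflect_apply, if_pos (Finset.mem_univ i)]
      have := Finsupp.le_def.1 hm i
      omega
    rw [← hsum, pow_add]
    ring

/-- **Coefficients of the box cut above the box**: `coeff_m f_{lo,hi} = 0` unless `m + lo ≤ hi`.
[cite: Branden2007, §3 ("`supp(f_{α,β}) = {γ - α : γ ∈ supp(f) ∩ [α, β]}`")] -/
theorem coeff_boxCut_of_not_le {p : MvPolynomial σ ℂ} {lo hi m : σ →₀ ℕ} (h : ¬ m + lo ≤ hi) :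
    coeff m (boxCut lo hi p) = 0 := by
  obtain ⟨c, _, hc⟩ := coeff_lowerCut lo (upperCut (hi ⊓ degVec p) p) m
  rw [boxCut, hc, (coeff_upperCut (inf_le_right : hi ⊓ degVec p ≤ degVec p) (m + lo)).1
    (fun h' => h (h'.trans inf_le_left)), mul_zero]

/-- **Coefficients of the box cut inside the box**: for `m + lo ≤ hi`,
`coeff_m f_{lo,hi} = ± c · coeff_{m+lo} p` with `c` a positive integer and the SAME sign `(-1)^{|hi ⊓ κ|}` for all
`m`. [cite: Branden2007, §3 ("`supp(f_{α,β}) = {γ - α : γ ∈ supp(f) ∩ [α, β]}`")] -/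
theorem coeff_boxCut {p : MvPolynomial σ ℂ} {lo hi m : σ →₀ ℕ} (h : m + lo ≤ hi) :
    ∃ c : ℕ, 0 < c ∧
      coeff m (boxCut lo hi p) = (-1) ^ (hi ⊓ degVec p).degree * (c * coeff (m + lo) p) := by
  obtain ⟨c₁, hc₁, h₁⟩ := coeff_lowerCut lo (upperCut (hi ⊓ degVec p) p) m
  by_cases hκ : m + lo ≤ degVec p
  · obtain ⟨c₂, hc₂, h₂⟩ :=
      (coeff_upperCut (inf_le_right : hi ⊓ degVec p ≤ degVec p) (m + lo)).2 (le_inf h hκ)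
    refine ⟨c₁ * c₂, by positivity, ?_⟩
    rw [boxCut, h₁, h₂]
    push_cast
    ring
  · have hp0 : coeff (m + lo) p = 0 := by
      by_contra hne
      exact hκ (le_degVec hne)
    refine ⟨1, one_pos, ?_⟩
    rw [boxCut, h₁, (coeff_upperCut (inf_le_right : hi ⊓ degVec p ≤ degVec p) (m + lo)).1
      (fun h' => hκ (h'.trans inf_le_right)), hp0]
    simp

/-- **`supp f_{lo,hi} = {γ - lo : γ ∈ supp p ∩ [lo, hi]}`.**
[cite: Branden2007, §3 ("`supp(f_{α,β}) = {γ - α : γ ∈ supp(f) ∩ [α, β]}`")] -/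
theorem coeff_boxCut_ne_zero_iff (p : MvPolynomial σ ℂ) (lo hi m : σ →₀ ℕ) :
    coeff m (boxCut lo hi p) ≠ 0 ↔ m + lo ≤ hi ∧ coeff (m + lo) p ≠ 0 := by
  by_cases h : m + lo ≤ hi
  · obtain ⟨c, hc, hcm⟩ := coeff_boxCut (p := p) h
    rw [hcm]
    simp only [ne_eq, mul_eq_zero, neg_one_pow_ne_zero', Nat.cast_eq_zero, hc.ne', false_or, h, true_and]
  · simp only [coeff_boxCut_of_not_le h, ne_eq, not_true_eq_false, h, false_and]

/-- **The upper cut is `0` or stable** (flips and `∂` preserve stability). [cite: Branden2007, §3 ("`g(z)` is also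
`H̄`-stable", "`f_{α,β}` is `H`-stable")] -/
theorem IsUpperHalfPlaneStable.upperCut_eq_zero_or {p : MvPolynomial σ ℂ} (hst : IsUpperHalfPlaneStable p)
    {hi : σ →₀ ℕ} (hhi : hi ≤ degVec p) :
    upperCut hi p = 0 ∨ IsUpperHalfPlaneStable (upperCut hi p) := by
  have h1 : IsUpperHalfPlaneStable (StablePolynomials.flipVars Finset.univ (degVec p) p) :=
    hst.flipVars (fits_degVec p _)
  rcases h1.lowerCut_eq_zero_or (degVec p - hi) with h2 | h2
  · left
    rw [upperCut, h2, flipVars_zero]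
  · right
    refine h2.flipVars fun n hn i _ => ?_
    have h3 := (coeff_lowerCut_ne_zero_iff _ _ n).1 (mem_support_iff.1 hn)
    have h4 := flipVars_fits Finset.univ (degVec p) p _ (mem_support_iff.2 h3) i (Finset.mem_univ i)
    have h5 := Finsupp.le_def.1 hhi i
    simp only [Finsupp.add_apply, Finsupp.tsub_apply] at h4
    omega

/-- **`f_{lo,hi}` is `0` or stable.** [cite: Branden2007, §3 ("`f_{α,β}` is `H`-stable")] -/
theorem IsUpperHalfPlaneStable.boxCut_eq_zero_or {p : MvPolynomial σ ℂ} (hst : IsUpperHalfPlaneStable p)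
    (lo hi : σ →₀ ℕ) : boxCut lo hi p = 0 ∨ IsUpperHalfPlaneStable (boxCut lo hi p) := by
  rcases hst.upperCut_eq_zero_or (inf_le_right : hi ⊓ degVec p ≤ degVec p) with h | h
  · left
    rw [boxCut, h, lowerCut_zero]
  · exact h.lowerCut_eq_zero_or lo

/-- **`f_{α,β}` is stable** when `α ≤ β` and `α ∈ supp p` (then `0 ∈ supp f_{α,β}`, so it is not the zero
polynomial). [cite: Branden2007, §3 ("`f_{α,β}` is `H`-stable", for `α, β ∈ supp(f)` with `α ≤ β`)] -/
theorem IsUpperHalfPlaneStable.boxCut {p : MvPolynomial σ ℂ} (hst : IsUpperHalfPlaneStable p)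
    {lo hi : σ →₀ ℕ} (hlo : coeff lo p ≠ 0) (hle : lo ≤ hi) : IsUpperHalfPlaneStable (boxCut lo hi p) := by
  rcases hst.boxCut_eq_zero_or lo hi with h | h
  · exfalso
    have : coeff 0 (StablePolynomials.boxCut lo hi p) ≠ 0 :=
      (coeff_boxCut_ne_zero_iff p lo hi 0).2 ⟨by simpa using hle, by simpa using hlo⟩
    exact this (by rw [h, coeff_zero])
  · exact h

end BoxCut

/-! ## §5 The last paragraph of the proof: the normalized counterexample is impossible -/

section Normalized

/-- **"At least one of the `N`th roots of a non-zero complex number is in any given half-plane whose boundary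
contains the origin"** (`N ≥ 3`), for the upper half-plane: `ζ = |w|^{1/N} e^{iθ}` with `θ = arg w / N` or
`(arg w + 2π)/N`, whichever lies in `(0, π)`. [cite: Branden2007, §3 proof of Thm. 3.2 (last sentence)] -/
theorem exists_im_pos_pow_eq (w : ℂ) (hw : w ≠ 0) {N : ℕ} (hN : 3 ≤ N) :
    ∃ ζ : ℂ, 0 < ζ.im ∧ ζ ^ N = w := by
  have hN0 : (0 : ℝ) < N := by exact_mod_cast (by omega : 0 < N)
  have hN3 : (3 : ℝ) ≤ N := by exact_mod_cast hN
  have hπ := Real.pi_pos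
  have hargle := Complex.arg_le_pi w
  have harggt := Complex.neg_pi_lt_arg w
  have hNc : (N : ℂ) ≠ 0 := by exact_mod_cast (by omega : N ≠ 0)
  -- the angle
  obtain ⟨θ, hθpos, hθlt, hθexp⟩ : ∃ θ : ℝ, 0 < θ ∧ θ < Real.pi ∧
      Complex.exp ((N : ℂ) * (θ * Complex.I)) = Complex.exp (Complex.arg w * Complex.I) := by
    by_cases h : 0 < Complex.arg w
    · refine ⟨Complex.arg w / N, div_pos h hN0, ?_, ?_⟩
      · rw [div_lt_iff₀ hN0]
        nlinarith
      · congr 1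
        push_cast
        rw [← mul_assoc, mul_div_cancel₀ _ hNc]
    · have h' := not_lt.1 h
      refine ⟨(Complex.arg w + 2 * Real.pi) / N, div_pos (by linarith) hN0, ?_, ?_⟩
      · rw [div_lt_iff₀ hN0]
        nlinarith
      · have : (N : ℂ) * ((((Complex.arg w + 2 * Real.pi) / N : ℝ) : ℂ) * Complex.I) =
            Complex.arg w * Complex.I + 2 * Real.pi * Complex.I := by
          push_cast
          rw [← mul_assoc, mul_div_cancel₀ _ hNc, add_mul]
        rw [this, Complex.exp_add, Complex.exp_two_pi_mul_I, mul_one]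
  refine ⟨((‖w‖ ^ ((N : ℝ)⁻¹) : ℝ) : ℂ) * Complex.exp (θ * Complex.I), ?_, ?_⟩
  · rw [Complex.im_ofReal_mul, Complex.exp_ofReal_mul_I_im]
    exact mul_pos (Real.rpow_pos_of_pos (norm_pos_iff.2 hw) _) (Real.sin_pos_of_pos_of_lt_pi hθpos hθlt)
  · rw [mul_pow, ← Complex.ofReal_pow, Real.rpow_inv_natCast_pow (norm_nonneg w) (by omega),
      ← Complex.exp_nat_mul, hθexp]
    exact Complex.norm_mul_exp_arg_mul_I w

variable [Fintype σ] [DecidableEq σ]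

/-- **The normalized counterexample is impossible** (the last paragraph of the printed proof). If `p` is stable
with `a(0) a(β) ≠ 0`, `βₖ ≠ 0`, `eₖ ∉ supp p`, no `eₖ + eⱼ` with `(eₖ)ⱼ < βⱼ` in `supp p` (the two-step axiom fails
for `0`, `β`, `σ = eₖ`), and "if `γₖ > 0` then `a(γ) = 0` unless `γ = β`", then: contradiction. Proof as printed:
the univariate polynomials `p(λ^{c₁} z, …, λ^{cₙ} z)` (`cₖ = -S`, `cᵢ = βₖ` otherwise, `S = |β| - βₖ`) are
stable for `λ > 0` and converge coefficientwise to `a(0) + a(β) z^{|β|}` as `λ → 0⁺`, which is stable by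
Hurwitz's theorem (`Limits`), `|β| ≥ 3` because `|β| ≤ 2` would validate the two-step axiom, and
`a(0) + a(β) z^N` (`N ≥ 3`) has a zero in the upper half-plane. [cite: Branden2007, §3 proof of Thm. 3.2
(from "Hence, if `γ ∈ ℕⁿ` with `γ₁ > 0` then `a(γ) = 0` unless `γ = β`" to the end)] -/
theorem false_of_normalized {p : MvPolynomial σ ℂ} (hp : IsUpperHalfPlaneStable p) {β : σ →₀ ℕ} {k : σ}
    (h0 : coeff 0 p ≠ 0) (hβ : coeff β p ≠ 0) (hk : β k ≠ 0) (hγ : coeff (Finsupp.single k 1) p = 0)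
    (hδ : ∀ j, Finsupp.single k 1 j < β j → coeff (Finsupp.single k 1 + Finsupp.single j 1) p = 0)
    (hside : ∀ ξ, coeff ξ p ≠ 0 → ξ ≠ β → ξ k = 0) : False := by
  -- (a) `|β| ≥ 3`
  set N := β.degree with hN
  have hN3 : 3 ≤ N := by
    by_contra hlt
    have hsplit : β - Finsupp.single k 1 + Finsupp.single k 1 = β := Finsupp.sub_add_single_one_cancel hk
    set β' := β - Finsupp.single k 1 with hβ'
    have hdeg : β'.degree + 1 = N := by
      have := congrArg Finsupp.degree hsplit
      rwa [map_add, Finsupp.degree_single] at this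
    have hcases : β'.degree = 0 ∨ β'.degree = 1 := by omega
    rcases hcases with hd | hd
    · rw [(Finsupp.degree_eq_zero_iff _).1 hd, zero_add] at hsplit
      exact hβ (hsplit ▸ hγ)
    · obtain ⟨j, hj⟩ := exists_eq_single_of_degree_eq_one hd
      rw [hj, add_comm] at hsplit
      have hlt' : Finsupp.single k 1 j < β j := by
        rw [← hsplit, Finsupp.add_apply, Finsupp.single_eq_same]
        omega
      exact hβ (hsplit ▸ hδ j hlt')
  have hN0 : N ≠ 0 := by omega
  -- (b) the weights
  set b := β k with hb
  set S := N - b with hS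
  have hbN : b ≤ N := Finsupp.le_degree k β
  have hb0 : b ≠ 0 := hk
  let c : ℝ → σ → ℂ := fun t i => if i = k then (((t : ℂ) ^ S)⁻¹) else (t : ℂ) ^ b
  let w : ℝ → (σ →₀ ℕ) → ℂ := fun t ξ => ∏ i, c t i ^ ξ i
  let u : ℝ → MvPolynomial Unit ℂ := fun t => bind₁ (fun i => C (c t i) * X ()) p
  -- (c) stability of the scaled univariate polynomials
  have hu_stable : ∀ t : ℝ, 0 < t → IsUpperHalfPlaneStable (u t) := by
    intro t ht z hz
    simp only [u]
    rw [eval_bind₁]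
    refine hp _ fun i => ?_
    have hc : ∃ r : ℝ, 0 < r ∧ c t i = r := by
      by_cases hi : i = k
      · refine ⟨(t ^ S)⁻¹, by positivity, ?_⟩
        simp only [c, if_pos hi, Complex.ofReal_inv, Complex.ofReal_pow]
      · exact ⟨t ^ b, by positivity, by simp only [c, if_neg hi, Complex.ofReal_pow]⟩
    obtain ⟨r, hr, hcr⟩ := hc
    simp only [map_mul, eval_C, eval_X, hcr, Complex.im_ofReal_mul]
    exact mul_pos hr (hz ())
  -- (d) the scaled polynomial as a sum of monomials
  have hu_eq : ∀ t, u t = ∑ ξ ∈ p.support, monomial (Finsupp.single () ξ.degree) (coeff ξ p * w t ξ) := by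
    intro t
    simp only [u]
    conv_lhs => rw [p.as_sum, map_sum]
    refine Finset.sum_congr rfl fun ξ _ => ?_
    rw [bind₁_monomial]
    have hprod : ∏ i ∈ ξ.support, (C (c t i) * X (R := ℂ) (σ := Unit) ()) ^ ξ i =
        C (w t ξ) * X () ^ ξ.degree := by
      simp only [w, mul_pow, Finset.prod_mul_distrib, ← map_pow, ← map_prod, Finset.prod_pow_eq_pow_sum,
        Finsupp.degree_apply]
      congr 2
      exact Finset.prod_subset (Finset.subset_univ _) fun i _ hi => by
        rw [Finsupp.notMem_support_iff.1 hi, pow_zero]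
    rw [hprod, X_pow_eq_monomial, C_mul_monomial, C_mul_monomial, mul_one]
  have hcoeff_u : ∀ t m, coeff (Finsupp.single () m) (u t) =
      ∑ ξ ∈ p.support, if ξ.degree = m then coeff ξ p * w t ξ else 0 := by
    intro t m
    rw [hu_eq, coeff_sum]
    refine Finset.sum_congr rfl fun ξ _ => ?_
    simp only [coeff_monomial, (Finsupp.single_injective ()).eq_iff]
  -- (e) closed forms of the weights
  have hw_side : ∀ t ξ, ξ k = 0 → w t ξ = (t : ℂ) ^ (b * ξ.degree) := by
    intro t ξ hξ
    simp only [w]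
    rw [Finsupp.degree_eq_sum, Finset.mul_sum, ← Finset.prod_pow_eq_pow_sum]
    refine Finset.prod_congr rfl fun i _ => ?_
    by_cases hi : i = k
    · subst hi
      rw [hξ, pow_zero, mul_zero, pow_zero]
    · simp only [c, if_neg hi, ← pow_mul]
  have hw_β : ∀ t : ℝ, t ≠ 0 → w t β = 1 := by
    intro t ht
    simp only [w]
    rw [← Finset.mul_prod_erase Finset.univ _ (Finset.mem_univ k)]
    have : ∏ i ∈ Finset.univ.erase k, c t i ^ β i = ∏ i ∈ Finset.univ.erase k, ((t : ℂ) ^ b) ^ β i :=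
      Finset.prod_congr rfl fun i hi => by simp only [c, if_neg (Finset.ne_of_mem_erase hi)]
    rw [this, Finset.prod_pow_eq_pow_sum]
    have hsum : ∑ i ∈ Finset.univ.erase k, β i = S := by
      have h1 := Finset.add_sum_erase Finset.univ (fun i => β i) (Finset.mem_univ k)
      rw [← Finsupp.degree_eq_sum] at h1
      omega
    rw [hsum]
    simp only [c, if_pos rfl]
    have ht' : (t : ℂ) ≠ 0 := Complex.ofReal_ne_zero.2 ht
    rw [← hb, inv_pow, ← pow_mul, ← pow_mul, mul_comm S b, inv_mul_cancel₀ (pow_ne_zero _ ht')]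
  have hw_zero : ∀ t, w t 0 = 1 := by
    intro t
    simp only [w, Finsupp.coe_zero, Pi.zero_apply, pow_zero, Finset.prod_const_one]
  -- (f) the limit polynomial `a(0) + a(β) z^N` and the finite set of exponents
  set a₀ := coeff 0 p with ha₀
  set aβ := coeff β p with haβ
  set L : MvPolynomial Unit ℂ := monomial 0 a₀ + monomial (Finsupp.single () N) aβ with hL
  set D : Finset (Unit →₀ ℕ) := p.support.image fun ξ => Finsupp.single () ξ.degree with hD
  have hsN : (Finsupp.single () N : Unit →₀ ℕ) ≠ 0 := by
    rwa [Ne, Finsupp.single_eq_zero]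
  have h0β : (0 : σ →₀ ℕ) ≠ β := by
    intro h
    apply hN0
    rw [hN, ← h, map_zero]
  have hFD : ∀ t, (u t).support ⊆ D := by
    intro t n hn
    rw [hu_eq] at hn
    obtain ⟨ξ, hξ, hnξ⟩ := Finset.mem_biUnion.1 (support_sum hn)
    rw [hD, Finset.mem_image]
    exact ⟨ξ, hξ, (Finset.mem_singleton.1 (support_monomial_subset hnξ)).symm⟩
  have hLD : L.support ⊆ D := by
    intro n hn
    rw [hL] at hn
    rw [hD, Finset.mem_image]
    rcases Finset.mem_union.1 (support_add hn) with h | h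
    · have h' := Finset.mem_singleton.1 (support_monomial_subset h)
      exact ⟨0, mem_support_iff.2 h0, by rw [h', map_zero, Finsupp.single_zero]⟩
    · have h' := Finset.mem_singleton.1 (support_monomial_subset h)
      exact ⟨β, mem_support_iff.2 hβ, by rw [h']⟩
  have hcoeff_L : ∀ m, coeff (Finsupp.single () m) L =
      (if 0 = m then a₀ else 0) + (if N = m then aβ else 0) := by
    intro m
    rw [hL, coeff_add, coeff_monomial, coeff_monomial]
    congr 1
    · have : ((0 : Unit →₀ ℕ) = Finsupp.single () m) ↔ 0 = m := by
        rw [← Finsupp.single_zero (), (Finsupp.single_injective ()).eq_iff]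
      simp only [this]
    · simp only [(Finsupp.single_injective ()).eq_iff]
  -- (g) coefficientwise convergence `u t → L` as `t → 0⁺`
  have hlim : ∀ n ∈ D, Tendsto (fun t => coeff n (u t)) (𝓝[>] (0 : ℝ)) (𝓝 (coeff n L)) := by
    intro n _
    obtain ⟨m, rfl⟩ : ∃ m, n = Finsupp.single () m := ⟨n (), Finsupp.unique_single n⟩
    simp only [hcoeff_u, hcoeff_L]
    -- the limit of each summand
    let lim : (σ →₀ ℕ) → ℂ := fun ξ =>
      if ξ.degree = m then coeff ξ p * (if ξ = 0 ∨ ξ = β then 1 else 0) else 0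
    have hterm : ∀ ξ ∈ p.support, Tendsto (fun t => if ξ.degree = m then coeff ξ p * w t ξ else 0)
        (𝓝[>] (0 : ℝ)) (𝓝 (lim ξ)) := by
      intro ξ hξ
      simp only [lim]
      by_cases hdm : ξ.degree = m
      · simp only [if_pos hdm]
        refine Tendsto.const_mul _ ?_
        by_cases h0 : ξ = 0
        · subst h0
          simp only [hw_zero, true_or, if_true]
          exact tendsto_const_nhds
        by_cases hξβ : ξ = β
        · subst hξβ
          simp only [or_true, if_true]
          refine tendsto_const_nhds.congr' ?_
          filter_upwards [self_mem_nhdsWithin] with t ht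
          exact (hw_β t (ne_of_gt ht)).symm
        · simp only [h0, hξβ, or_self, if_false]
          have hξk : ξ k = 0 := hside ξ (mem_support_iff.1 hξ) hξβ
          simp only [hw_side _ ξ hξk]
          have hpow : b * ξ.degree ≠ 0 :=
            Nat.mul_ne_zero hb0 fun h => h0 ((Finsupp.degree_eq_zero_iff ξ).1 h)
          have hcont : Continuous (fun t : ℝ => (t : ℂ) ^ (b * ξ.degree)) :=
            Complex.continuous_ofReal.pow _
          have hc := hcont.tendsto 0
          rw [Complex.ofReal_zero, zero_pow hpow] at hc
          exact hc.mono_left nhdsWithin_le_nhds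
      · simp only [if_neg hdm]
        exact tendsto_const_nhds
    have hsum := tendsto_finsetSum p.support hterm
    have hlimsum : ∑ ξ ∈ p.support, lim ξ = (if 0 = m then a₀ else 0) + (if N = m then aβ else 0) := by
      rw [Finset.sum_eq_add_of_mem (0 : σ →₀ ℕ) β (mem_support_iff.2 h0) (mem_support_iff.2 hβ) h0β]
      · simp only [lim, map_zero, ← hN, true_or, or_true, if_true, mul_one, ha₀, haβ]
      · intro ξ _ hne
        simp only [lim, hne.1, hne.2, or_self, if_false, mul_zero, ite_self]
    rw [hlimsum] at hsum
    exact hsum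
  -- (h) Hurwitz: the limit is stable (it is not zero), yet it has a zero in the upper half-plane
  have hev : ∀ᶠ t in 𝓝[>] (0 : ℝ), IsUpperHalfPlaneStable (u t) :=
    eventually_nhdsWithin_of_forall fun t (ht : t ∈ Set.Ioi (0 : ℝ)) => hu_stable t ht
  have hF : ∃ᶠ t in 𝓝[>] (0 : ℝ), IsUpperHalfPlaneStable (u t) := hev.frequently
  rcases eq_zero_or_isUpperHalfPlaneStable_of_tendsto_coeff D (Eventually.of_forall hFD) hLD hlim hF with
    hL0 | hLst
  · have := hcoeff_L 0
    rw [hL0, coeff_zero, if_pos rfl, if_neg hN0, add_zero] at this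
    exact h0 this.symm
  · obtain ⟨ζ, hζ, hζN⟩ := exists_im_pos_pow_eq (-a₀ / aβ) (div_ne_zero (neg_ne_zero.2 h0) hβ) hN3
    refine hLst (fun _ => ζ) (fun _ => hζ) ?_
    simp only [hL, map_add, eval_monomial, Finsupp.prod_zero_index, Finsupp.prod_single_index, pow_zero,
      mul_one]
    rw [hζN, mul_comm aβ, div_mul_cancel₀ _ hβ]
    ring

end Normalized

/-! ## §6 The two-step axiom for `α ≤ β` (the minimal counterexample, as a strong induction on `|β - α|`) -/

section TwoStep

variable [Fintype σ] [DecidableEq σ]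

/-- **The two-step axiom for a stable polynomial, case `α ≤ β`.** If `α ≤ β` are in the support of a stable `p`,
`αₖ < βₖ` and `α + eₖ ∉ supp p`, then `α + eₖ + eⱼ ∈ supp p` for some `j` with `(α + eₖ)ⱼ < βⱼ`. Proof as printed:
a counterexample with `|β - α|` minimal is cut down to `f_{α,β}` (`boxCut`: `a(0) a(β - α) ≠ 0`,
`supp ⊆ [0, β - α]`); minimality (here: the induction hypothesis, applied to `0 ≤ ξ` in `f_{α,β}`) shows "if `γₖ > 0`
then `a(γ) = 0` unless `γ = β`", and `false_of_normalized` finishes. [cite: Branden2007, §3 Thm. 3.2 (proof)] -/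
theorem IsUpperHalfPlaneStable.twoStep_of_le {p : MvPolynomial σ ℂ} (hp : IsUpperHalfPlaneStable p)
    {α β : σ →₀ ℕ} (hle : α ≤ β) (hα : coeff α p ≠ 0) (hβ : coeff β p ≠ 0) {k : σ} (hk : α k < β k)
    (hγ : coeff (α + Finsupp.single k 1) p = 0) :
    ∃ j, (α + Finsupp.single k 1 : σ →₀ ℕ) j < β j ∧
      coeff (α + Finsupp.single k 1 + Finsupp.single j 1) p ≠ 0 := by
  suffices H : ∀ (N : ℕ) (p : MvPolynomial σ ℂ) (α β : σ →₀ ℕ) (k : σ), (β - α).degree = N →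
      IsUpperHalfPlaneStable p → α ≤ β → coeff α p ≠ 0 → coeff β p ≠ 0 → α k < β k →
      coeff (α + Finsupp.single k 1) p = 0 →
      ∃ j, (α + Finsupp.single k 1 : σ →₀ ℕ) j < β j ∧
        coeff (α + Finsupp.single k 1 + Finsupp.single j 1) p ≠ 0 from
    H _ p α β k rfl hp hle hα hβ hk hγ
  intro N
  induction N using Nat.strong_induction_on with
  | _ N ih =>
  intro p α β k hN hp hle hα hβ hk hγ
  by_contra hcon
  have hcon' : ∀ j, (α + Finsupp.single k 1 : σ →₀ ℕ) j < β j →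
      coeff (α + Finsupp.single k 1 + Finsupp.single j 1) p = 0 :=
    fun j hj => Classical.byContradiction fun hne => hcon ⟨j, hj, hne⟩
  -- cut down to `f_{α,β}`
  set q := StablePolynomials.boxCut α β p with hq
  have hqc : ∀ m, coeff m q ≠ 0 ↔ m + α ≤ β ∧ coeff (m + α) p ≠ 0 := fun m =>
    coeff_boxCut_ne_zero_iff p α β m
  have hq0 : coeff 0 q ≠ 0 := (hqc 0).2 ⟨by simpa using hle, by simpa using hα⟩
  have hqst : IsUpperHalfPlaneStable q := hp.boxCut hα hle
  set β₀ := β - α with hβ₀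
  have hβ₀α : β₀ + α = β := tsub_add_cancel_of_le hle
  have hqβ : coeff β₀ q ≠ 0 := (hqc β₀).2 ⟨hβ₀α.le, by rwa [hβ₀α]⟩
  have hβ₀k : β₀ k ≠ 0 := by
    rw [hβ₀, Finsupp.tsub_apply]
    omega
  have hqγ : coeff (Finsupp.single k 1) q = 0 := by
    by_contra h
    have := ((hqc _).1 h).2
    rw [add_comm] at this
    exact this hγ
  have hqδ : ∀ j, Finsupp.single k 1 j < β₀ j →
      coeff (Finsupp.single k 1 + Finsupp.single j 1) q = 0 := by
    intro j hj
    by_contra h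
    obtain ⟨-, h2⟩ := (hqc _).1 h
    have hj' : (α + Finsupp.single k 1 : σ →₀ ℕ) j < β j := by
      rw [hβ₀, Finsupp.tsub_apply] at hj
      rw [Finsupp.add_apply]
      omega
    refine h2 ?_
    rw [show Finsupp.single k 1 + Finsupp.single j 1 + α = α + Finsupp.single k 1 + Finsupp.single j 1 by
      rw [add_comm, add_assoc]]
    exact hcon' j hj'
  -- minimality: every other support point of `f_{α,β}` has `k`-th coordinate `0`
  have hqside : ∀ ξ, coeff ξ q ≠ 0 → ξ ≠ β₀ → ξ k = 0 := by
    intro ξ hξ hne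
    by_contra hξk
    obtain ⟨hξle', -⟩ := (hqc ξ).1 hξ
    have hξle : ξ ≤ β₀ := Finsupp.le_def.2 fun i => by
      have := Finsupp.le_def.1 hξle' i
      rw [Finsupp.add_apply] at this
      rw [hβ₀, Finsupp.tsub_apply]
      omega
    have hlt : ξ.degree < N := by
      rw [← hN]
      exact degree_lt_degree_of_lt (lt_of_le_of_ne hξle hne)
    obtain ⟨j, hj, hj2⟩ := ih ξ.degree hlt q 0 ξ k (by rw [tsub_zero]) hqst
      (Finsupp.le_def.2 fun i => Nat.zero_le _) hq0 hξ
      (by rw [Finsupp.coe_zero, Pi.zero_apply]; exact Nat.pos_of_ne_zero hξk) (by rwa [zero_add])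
    rw [zero_add] at hj hj2
    exact hj2 (hqδ j (lt_of_lt_of_le hj (Finsupp.le_def.1 hξle j)))
  exact false_of_normalized hqst hq0 hqβ hβ₀k hqγ hqδ hqside

end TwoStep

/-! ## §7 Theorem 3.2: the support of a polynomial with the half-plane property is a jump system -/

section JumpSystem

variable [Fintype σ] [DecidableEq σ]

/-- **Theorem 3.2 for upper half-plane stable polynomials**: the support `{m : coeff_m p ≠ 0}` of a stable
polynomial is a jump system. Proof as printed: reflect the coordinates `{i : βᵢ < αᵢ}` (`flipVars`, "it is no
restriction in assuming that `α ≤ β`"), apply `twoStep_of_le`, and reflect back.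
[cite: Branden2007, §3 Thm. 3.2] -/
theorem IsUpperHalfPlaneStable.isJumpSystem_support {p : MvPolynomial σ ℂ} (hp : IsUpperHalfPlaneStable p) :
    IsJumpSystem {m : σ →₀ ℕ | coeff m p ≠ 0} := by
  intro α β γ hα hβ hstep hγ
  simp only [Set.mem_setOf_eq, not_not] at hα hβ hγ
  set I : Finset σ := Finset.univ.filter fun i => β i < α i with hI
  set κ := degVec p with hκ
  have hfit : ∀ m ∈ p.support, ∀ i ∈ I, m i ≤ κ i := fits_degVec p I
  have hακ : ∀ i ∈ I, α i ≤ κ i := hfit α (mem_support_iff.2 hα)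
  have hβκ : ∀ i ∈ I, β i ≤ κ i := hfit β (mem_support_iff.2 hβ)
  have hγκ : ∀ i ∈ I, γ i ≤ κ i :=
    fun i hi => (hstep.apply_le_max i).trans (max_le (hακ i hi) (hβκ i hi))
  have hmemI : ∀ i, i ∈ I ↔ β i < α i := fun i => by
    rw [hI, Finset.mem_filter]
    simp only [Finset.mem_univ, true_and]
  -- the reflected data
  set p' := StablePolynomials.flipVars I κ p with hp'
  have hst' : IsUpperHalfPlaneStable p' := hp.flipVars hfit
  set α' := boxReflect I κ α with hα'
  set β' := boxReflect I κ β with hβ'def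
  have hle : α' ≤ β' := Finsupp.le_def.2 fun i => by
    by_cases hi : i ∈ I
    · have h1 := (hmemI i).1 hi
      have h2 := hβκ i hi
      rw [hα', hβ'def, boxReflect_apply, if_pos hi, boxReflect_apply, if_pos hi]
      omega
    · have h1 : ¬ β i < α i := fun h => hi ((hmemI i).2 h)
      rw [hα', hβ'def, boxReflect_apply, if_neg hi, boxReflect_apply, if_neg hi]
      omega
  have hstep' : IsStep α' β' (boxReflect I κ γ) := hstep.boxReflect hακ hβκ hγκ
  obtain ⟨k, hk, hγ'eq⟩ := (isStep_iff_of_le hle).1 hstep'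
  have hα'c : coeff α' p' ≠ 0 := by
    rw [hα', hp', coeff_boxReflect_flipVars hfit hακ]
    exact mul_ne_zero (neg_one_pow_ne_zero' _) hα
  have hβ'c : coeff β' p' ≠ 0 := by
    rw [hβ'def, hp', coeff_boxReflect_flipVars hfit hβκ]
    exact mul_ne_zero (neg_one_pow_ne_zero' _) hβ
  have hγ'c : coeff (α' + Finsupp.single k 1) p' = 0 := by
    rw [← hγ'eq, hp', coeff_boxReflect_flipVars hfit hγκ, hγ, mul_zero]
  obtain ⟨j, hj, hδ'⟩ := hst'.twoStep_of_le hle hα'c hβ'c hk hγ'c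
  set δ' := α' + Finsupp.single k 1 + Finsupp.single j 1 with hδ'def
  have hδ'le : δ' ≤ β' := Finsupp.le_def.2 fun i => by
    rw [hδ'def, Finsupp.add_apply, Finsupp.single_apply]
    split_ifs with hji
    · subst hji
      exact Nat.succ_le_of_lt hj
    · rw [add_zero, Finsupp.add_apply, Finsupp.single_apply]
      split_ifs with hki
      · subst hki
        exact Nat.succ_le_of_lt hk
      · rw [add_zero]
        exact Finsupp.le_def.1 hle i
  have hδ'fit : ∀ i ∈ I, δ' i ≤ κ i :=
    fun i hi => (Finsupp.le_def.1 hδ'le i).trans (boxReflect_fits I κ β i hi)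
  refine ⟨boxReflect I κ δ', ?_, ?_⟩
  · have h1 : IsStep (α' + Finsupp.single k 1) β' δ' := isStep_add_single hj
    have h2 := h1.boxReflect (hγ'eq ▸ boxReflect_fits I κ γ) (boxReflect_fits I κ β) hδ'fit
    rwa [← hγ'eq, boxReflect_boxReflect hγκ, boxReflect_boxReflect hβκ] at h2
  · rw [Set.mem_setOf_eq]
    exact ((coeff_flipVars_ne_zero_iff hfit).1 hδ').2

/-- **Theorem 3.2 for real stable polynomials.** [cite: Branden2007, §3 Thm. 3.2] -/
theorem IsRealStable.isJumpSystem_support {f : MvPolynomial σ ℝ} (hf : IsRealStable f) :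
    IsJumpSystem {m : σ →₀ ℕ | coeff m f ≠ 0} := by
  have h := IsUpperHalfPlaneStable.isJumpSystem_support hf
  have hset : {m : σ →₀ ℕ | coeff m (map (algebraMap ℝ ℂ) f) ≠ 0} = {m : σ →₀ ℕ | coeff m f ≠ 0} := by
    ext m
    simp only [Set.mem_setOf_eq, coeff_map, ne_eq, map_eq_zero_iff _ (algebraMap ℝ ℂ).injective]
  rwa [hset] at h

omit [Fintype σ] [DecidableEq σ] in
/-- Coefficients under the diagonal scaling `zᵢ ↦ aᵢ zᵢ`: `coeff_m p(a z) = (∏ aᵢ^{mᵢ}) coeff_m p`.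
[cite: Branden2007, §3 proof of Thm. 3.2 ("`supp(f(z)) = supp(f(e^{-iθ} z))`")] -/
theorem coeff_bind₁_C_mul_X (a : σ → ℂ) (p : MvPolynomial σ ℂ) (m : σ →₀ ℕ) :
    coeff m (bind₁ (fun i => C (a i) * X i) p) = (m.prod fun i e => a i ^ e) * coeff m p := by
  classical
  induction p using MvPolynomial.induction_on' with
  | monomial d r =>
    rw [bind₁_monomial, coeff_monomial]
    have hprod : ∏ i ∈ d.support, (C (a i) * X (R := ℂ) i) ^ d i =
        C (d.prod fun i e => a i ^ e) * monomial d 1 := by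
      simp only [mul_pow, Finset.prod_mul_distrib, ← map_pow, ← map_prod, Finsupp.prod]
      rw [monomial_eq, C_1, one_mul, Finsupp.prod]
    rw [hprod, ← mul_assoc, ← map_mul, C_mul_monomial, mul_one, coeff_monomial]
    split_ifs with h
    · subst h
      ring
    · rw [mul_zero]
  | add p q hp hq => rw [map_add, coeff_add, coeff_add, hp, hq, mul_add]

/-- **The half-plane property** ("`P` is `H`-stable for some open half-plane `H` whose boundary contains the
origin"): there is a unit `u` with `p(z) ≠ 0` whenever every `u zᵢ` lies in the upper half-plane (every such
half-plane is `{z : Im(uz) > 0}` for a unique unit `u`). [cite: Branden2007, §1 (half-plane property)] -/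
def HasHalfPlaneProperty (p : MvPolynomial σ ℂ) : Prop :=
  ∃ u : ℂ, ‖u‖ = 1 ∧ ∀ z : σ → ℂ, (∀ i, 0 < (u * z i).im) → eval z p ≠ 0

omit [Fintype σ] [DecidableEq σ] in
/-- Upper half-plane stable polynomials have the half-plane property (`u = 1`). [cite: Branden2007, §1] -/
theorem IsUpperHalfPlaneStable.hasHalfPlaneProperty {p : MvPolynomial σ ℂ} (hp : IsUpperHalfPlaneStable p) :
    HasHalfPlaneProperty p :=
  ⟨1, by simp, fun z hz => hp z fun i => by simpa using hz i⟩

omit [Fintype σ] [DecidableEq σ] in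
/-- **Rotation to the upper half-plane** ("`f` is `H`-stable if and only if `f(e^{-iθ} z₁, …, e^{-iθ} zₙ)` is
Hurwitz stable. Moreover, `supp(f(z)) = supp(f(e^{-iθ} z))`"): if `p` has the half-plane property for
`H = {Im(uz) > 0}` then `p(u⁻¹ z)` is upper half-plane stable, with the same support. [cite: Branden2007, §3 proof
of Thm. 3.2 (first two sentences)] -/
theorem HasHalfPlaneProperty.exists_isUpperHalfPlaneStable {p : MvPolynomial σ ℂ}
    (hp : HasHalfPlaneProperty p) :
    ∃ u : ℂ, u ≠ 0 ∧ IsUpperHalfPlaneStable (bind₁ (fun i => C u⁻¹ * X i) p) ∧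
      ∀ m, coeff m (bind₁ (fun i => C u⁻¹ * X i) p) ≠ 0 ↔ coeff m p ≠ 0 := by
  obtain ⟨u, hu, h⟩ := hp
  have hu0 : u ≠ 0 := by
    rintro rfl
    simp at hu
  refine ⟨u, hu0, fun z hz => ?_, fun m => ?_⟩
  · rw [eval_bind₁]
    refine h _ fun i => ?_
    simpa [map_mul, eval_C, eval_X, ← mul_assoc, mul_inv_cancel₀ hu0] using hz i
  · rw [coeff_bind₁_C_mul_X, mul_ne_zero_iff]
    have : (m.prod fun _ e => u⁻¹ ^ e) ≠ 0 :=
      Finsupp.prod_ne_zero_iff.2 fun i _ => pow_ne_zero _ (inv_ne_zero hu0)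
    simp only [ne_eq, this, not_false_eq_true, true_and]

/-- **Brändén 2007, Theorem 3.2: "Suppose that `f` has the half-plane property. Then the support of `f` is a jump
system."** In particular (Cor. 3.3) the support of a multi-affine polynomial with the half-plane property,
a subset of `{0,1}ⁿ`, is a delta-matroid. [cite: Branden2007, §3 Thm. 3.2 and Cor. 3.3] -/
theorem HasHalfPlaneProperty.isJumpSystem_support {p : MvPolynomial σ ℂ} (hp : HasHalfPlaneProperty p) :
    IsJumpSystem {m : σ →₀ ℕ | coeff m p ≠ 0} := by
  obtain ⟨u, _, hst, hsupp⟩ := hp.exists_isUpperHalfPlaneStable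
  have hset : {m : σ →₀ ℕ | coeff m (bind₁ (fun i => C u⁻¹ * X i) p) ≠ 0} = {m : σ →₀ ℕ | coeff m p ≠ 0} :=
    Set.ext fun m => hsupp m
  rw [← hset]
  exact hst.isJumpSystem_support

end JumpSystem

/-! ## §8 Corollary 3.7: real stable polynomials with nonnegative coefficients have no internal zeros -/

section NoInternalZeros

variable [Fintype σ] [DecidableEq σ]

omit [DecidableEq σ] in
/-- Evaluation as a sum over any finite set containing the support. [folklore] -/
private theorem eval_eq_sum_of_support_subset {R : Type*} [CommSemiring R] {q : MvPolynomial σ R}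
    {S : Finset (σ →₀ ℕ)} (hS : q.support ⊆ S) (z : σ → R) :
    eval z q = ∑ d ∈ S, coeff d q * ∏ i, z i ^ d i := by
  rw [MvPolynomial.eval_eq']
  exact Finset.sum_subset hS fun d _ hd => by rw [notMem_support_iff.1 hd, zero_mul]

omit [Fintype σ] [DecidableEq σ] in
/-- An exponent vector below `eᵢ + eⱼ` (`i ≠ j`) is determined by its two coordinates. [folklore] -/
private theorem eq_single_add_single_of_le {d : σ →₀ ℕ} {i j : σ} (hij : i ≠ j)
    (hd : d ≤ Finsupp.single i 1 + Finsupp.single j 1) :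
    d = Finsupp.single i (d i) + Finsupp.single j (d j) := by
  classical
  ext l
  rw [Finsupp.add_apply, Finsupp.single_apply, Finsupp.single_apply]
  by_cases hli : i = l
  · subst hli
    rw [if_pos rfl, if_neg (Ne.symm hij), add_zero]
  · by_cases hlj : j = l
    · subst hlj
      rw [if_neg hli, if_pos rfl, zero_add]
    · rw [if_neg hli, if_neg hlj, add_zero]
      have := Finsupp.le_def.1 hd l
      rw [Finsupp.add_apply, Finsupp.single_apply, Finsupp.single_apply, if_neg hli, if_neg hlj] at this
      omega

omit [Fintype σ] [DecidableEq σ] in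
/-- An exponent vector below `2eᵢ` is a multiple of `eᵢ`. [folklore] -/
private theorem eq_single_of_le_two_single {d : σ →₀ ℕ} {i : σ} (hd : d ≤ Finsupp.single i 2) :
    d = Finsupp.single i (d i) := by
  classical
  ext l
  rw [Finsupp.single_apply]
  by_cases hli : i = l
  · subst hli
    rw [if_pos rfl]
  · rw [if_neg hli]
    have := Finsupp.le_def.1 hd l
    rw [Finsupp.single_apply, if_neg hli] at this
    omega

/-- **One step up inside `[α, β]`** (the heart of Cor. 3.7): for a real stable `f` with nonnegative coefficients,
`α ≤ β` in `supp f` and `αᵢ < βᵢ`, also `α + eᵢ ∈ supp f`. Proof as printed: otherwise the two-step axiom gives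
`ξ = α + eᵢ + eⱼ ∈ supp f`, and `f_{α,ξ} = a + b zⱼ + c zᵢzⱼ` (`ac > 0`; for `i = j`, `a + c zᵢ²`) is stable — but it
vanishes at a point of the upper half-plane (`zᵢ = i`, `zⱼ = -a/(b + ci)`; resp. `zᵢ = i√(a/c)`).
[cite: Branden2007, §3 Cor. 3.7 (proof)] -/
theorem IsRealStable.coeff_add_single_ne_zero {f : MvPolynomial σ ℝ} (hf : IsRealStable f)
    (hnn : ∀ m, 0 ≤ coeff m f) {α β : σ →₀ ℕ} (hle : α ≤ β) (hα : coeff α f ≠ 0) (hβ : coeff β f ≠ 0)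
    {i : σ} (hi : α i < β i) : coeff (α + Finsupp.single i 1) f ≠ 0 := by
  intro hγ
  set p := map (algebraMap ℝ ℂ) f with hp
  have hcp : ∀ m, coeff m p = ((coeff m f : ℝ) : ℂ) := fun m => by
    rw [hp, coeff_map]
    rfl
  have hst : IsUpperHalfPlaneStable p := hf
  have hαp : coeff α p ≠ 0 := by
    rw [hcp]
    exact_mod_cast hα
  have hβp : coeff β p ≠ 0 := by
    rw [hcp]
    exact_mod_cast hβ
  have hγp : coeff (α + Finsupp.single i 1) p = 0 := by
    rw [hcp, hγ, Complex.ofReal_zero]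
  obtain ⟨j, _, hξp⟩ := hst.twoStep_of_le hle hαp hβp hi hγp
  set ξ := α + Finsupp.single i 1 + Finsupp.single j 1 with hξ
  have hξf : coeff ξ f ≠ 0 := by
    rw [hcp] at hξp
    exact_mod_cast hξp
  -- the box cut `f_{α,ξ}`
  have hαξ : α ≤ ξ := Finsupp.le_def.2 fun l => by
    simp only [hξ, Finsupp.add_apply]
    omega
  set q := StablePolynomials.boxCut α ξ p with hq
  have hqst : IsUpperHalfPlaneStable q := hst.boxCut hαp hαξ
  -- its coefficients at `0`, `eᵢ`, `eⱼ`, `eᵢ + eⱼ`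
  have hm0 : (0 : σ →₀ ℕ) + α ≤ ξ := by rwa [zero_add]
  have hm2 : Finsupp.single i 1 + Finsupp.single j 1 + α ≤ ξ := Finsupp.le_def.2 fun l => by
    simp only [hξ, Finsupp.add_apply]
    omega
  have hm1 : Finsupp.single i 1 + α ≤ ξ := Finsupp.le_def.2 fun l => by
    simp only [hξ, Finsupp.add_apply]
    omega
  have hmj : Finsupp.single j 1 + α ≤ ξ := Finsupp.le_def.2 fun l => by
    simp only [hξ, Finsupp.add_apply]
    omega
  obtain ⟨s, hs⟩ : ∃ s : ℂ, (-1) ^ (ξ ⊓ degVec p).degree = s := ⟨_, rfl⟩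
  obtain ⟨c₀, hc₀, hq0⟩ := coeff_boxCut (p := p) hm0
  obtain ⟨c₂, hc₂, hq2⟩ := coeff_boxCut (p := p) hm2
  obtain ⟨cⱼ, _, hqj⟩ := coeff_boxCut (p := p) hmj
  have hq1 : coeff (Finsupp.single i 1) q = 0 := by
    obtain ⟨c₁, _, h⟩ := coeff_boxCut (p := p) hm1
    rw [hq, h, add_comm, hγp, mul_zero, mul_zero]
  rw [zero_add, hs] at hq0
  rw [add_comm _ α, ← add_assoc, ← hξ, hs] at hq2
  rw [hs] at hqj
  -- the real numbers `A, B, C` with `a = sA`, `b = sB`, `c = sC`, `A, C > 0`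
  set A : ℝ := c₀ * coeff α f with hA
  set B : ℝ := cⱼ * coeff (Finsupp.single j 1 + α) f with hB
  set C : ℝ := c₂ * coeff ξ f with hC
  have hApos : 0 < A := mul_pos (by exact_mod_cast hc₀) (lt_of_le_of_ne (hnn α) (Ne.symm hα))
  have hCpos : 0 < C := mul_pos (by exact_mod_cast hc₂) (lt_of_le_of_ne (hnn ξ) (Ne.symm hξf))
  have ha : coeff 0 q = s * A := by
    rw [hq, hq0, hcp, hA]
    push_cast
    ring
  have hc : coeff (Finsupp.single i 1 + Finsupp.single j 1) q = s * C := by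
    rw [hq, hq2, hcp, hC]
    push_cast
    ring
  have hb : coeff (Finsupp.single j 1) q = s * B := by
    rw [hq, hqj, hcp, hB]
    push_cast
    ring
  -- support of `f_{α,ξ}`
  have hsupp : ∀ d ∈ q.support, d ≤ Finsupp.single i 1 + Finsupp.single j 1 ∧ d ≠ Finsupp.single i 1 := by
    intro d hd
    have h1 := (coeff_boxCut_ne_zero_iff p α ξ d).1 (mem_support_iff.1 hd)
    refine ⟨Finsupp.le_def.2 fun l => ?_, fun h => (mem_support_iff.1 hd) (h ▸ hq1)⟩
    have := Finsupp.le_def.1 h1.1 l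
    simp only [hξ, Finsupp.add_apply] at this ⊢
    omega
  by_cases hij : i = j
  · -- `i = j`: `q = a + c zᵢ²`
    subst hij
    have hS : q.support ⊆ {0, Finsupp.single i 1 + Finsupp.single i 1} := by
      intro d hd
      obtain ⟨hdle, hdne⟩ := hsupp d hd
      rw [Finset.mem_insert, Finset.mem_singleton]
      have h2 : Finsupp.single i 1 + Finsupp.single i 1 = Finsupp.single i 2 := by
        rw [← Finsupp.single_add]
      rw [h2] at hdle ⊢
      have hdeq := eq_single_of_le_two_single hdle
      have hdi : d i ≤ 2 := by simpa using Finsupp.le_def.1 hdle i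
      have hcases : d i = 0 ∨ d i = 1 ∨ d i = 2 := by omega
      rcases hcases with h | h | h <;> rw [h] at hdeq
      · left
        rw [hdeq, Finsupp.single_zero]
      · exact (hdne hdeq).elim
      · right
        exact hdeq
    -- the point `zᵢ = i √(A/C)` (all coordinates equal)
    set r : ℝ := Real.sqrt (A / C) with hr
    have hrpos : 0 < r := Real.sqrt_pos.2 (div_pos hApos hCpos)
    have hr2 : (r : ℂ) ^ 2 = ((A / C : ℝ) : ℂ) := by
      rw [← Complex.ofReal_pow, hr, Real.sq_sqrt (div_pos hApos hCpos).le]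
    refine hqst (fun _ => Complex.I * r) (fun _ => by simpa using hrpos) ?_
    have h0ne : (0 : σ →₀ ℕ) ∉ ({Finsupp.single i 1 + Finsupp.single i 1} : Finset (σ →₀ ℕ)) := by
      rw [Finset.mem_singleton]
      intro h
      have := congrArg Finsupp.degree h
      rw [map_zero, map_add, Finsupp.degree_single] at this
      omega
    have hC0 : (C : ℂ) ≠ 0 := by exact_mod_cast hCpos.ne'
    have key : (C : ℂ) * (Complex.I * r) ^ 2 = -A := by
      rw [mul_pow, Complex.I_sq, hr2]
      push_cast
      field_simp
    rw [eval_eq_sum_of_support_subset hS, Finset.sum_insert h0ne, Finset.sum_singleton, ha, hc]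
    simp only [Finsupp.coe_zero, Pi.zero_apply, pow_zero, Finset.prod_const_one, mul_one,
      Finset.prod_pow_eq_pow_sum]
    rw [← Finsupp.degree_eq_sum, map_add, Finsupp.degree_single]
    linear_combination s * key
  · -- `i ≠ j`: `q = a + b zⱼ + c zᵢzⱼ`
    have hS : q.support ⊆ {0, Finsupp.single j 1, Finsupp.single i 1 + Finsupp.single j 1} := by
      intro d hd
      obtain ⟨hdle, hdne⟩ := hsupp d hd
      rw [Finset.mem_insert, Finset.mem_insert, Finset.mem_singleton]
      have hdeq := eq_single_add_single_of_le hij hdle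
      have hdi : d i ≤ 1 := by
        have := Finsupp.le_def.1 hdle i
        simpa [Finsupp.single_apply, hij, Ne.symm hij] using this
      have hdj : d j ≤ 1 := by
        have := Finsupp.le_def.1 hdle j
        simpa [Finsupp.single_apply, hij, Ne.symm hij] using this
      have hcases : (d i = 0 ∨ d i = 1) ∧ (d j = 0 ∨ d j = 1) := by omega
      rcases hcases with ⟨h1 | h1, h2 | h2⟩ <;> rw [h1, h2] at hdeq
      · left
        rw [hdeq, Finsupp.single_zero, Finsupp.single_zero, add_zero]
      · right; left
        rw [hdeq, Finsupp.single_zero, zero_add]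
      · exfalso
        apply hdne
        rw [hdeq, Finsupp.single_zero, add_zero]
      · right; right
        exact hdeq
    -- the point `zᵢ = i`, `zⱼ = -A/(B + Ci)` (all other coordinates `i`)
    have hden : ((B : ℂ) + (C : ℂ) * Complex.I) ≠ 0 := by
      intro h
      have := congrArg Complex.im h
      simp at this
      exact hCpos.ne' this
    set w : ℂ := -(A : ℂ) / ((B : ℂ) + (C : ℂ) * Complex.I) with hw
    have hwim : 0 < w.im := by
      have hre : ((B : ℂ) + (C : ℂ) * Complex.I).re = B := by simp
      have him : ((B : ℂ) + (C : ℂ) * Complex.I).im = C := by simp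
      rw [hw, Complex.div_im, hre, him]
      simp only [Complex.neg_im, Complex.ofReal_im, neg_zero, zero_mul, zero_div, zero_sub,
        Complex.neg_re, Complex.ofReal_re, neg_mul, neg_div, neg_neg]
      exact div_pos (mul_pos hApos hCpos) (Complex.normSq_pos.2 hden)
    let z : σ → ℂ := Function.update (fun _ => Complex.I) j w
    have hzj : z j = w := by simp [z]
    have hzi : z i = Complex.I := by simp [z, Function.update_of_ne hij]
    refine hqst z (fun l => ?_) ?_
    · by_cases hl : l = j
      · subst hl
        rwa [hzj]
      · simp [z, Function.update_of_ne hl]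
    have h0ne : (0 : σ →₀ ℕ) ∉
        ({Finsupp.single j 1, Finsupp.single i 1 + Finsupp.single j 1} : Finset (σ →₀ ℕ)) := by
      rw [Finset.mem_insert, Finset.mem_singleton]
      rintro (h | h)
      · exact (Finsupp.single_ne_zero.2 one_ne_zero) h.symm
      · have := congrArg Finsupp.degree h
        rw [map_zero, map_add, Finsupp.degree_single, Finsupp.degree_single] at this
        omega
    have h1ne : Finsupp.single j 1 ∉ ({Finsupp.single i 1 + Finsupp.single j 1} : Finset (σ →₀ ℕ)) := by
      rw [Finset.mem_singleton]
      intro h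
      have := congrArg Finsupp.degree h
      rw [map_add, Finsupp.degree_single, Finsupp.degree_single] at this
      omega
    -- the three monomials at `z`
    have hmon0 : ∏ l, z l ^ (0 : σ →₀ ℕ) l = 1 := by simp
    have hone : ∀ k : σ, ∏ l ∈ Finset.univ.erase k, z l ^ (Finsupp.single k 1 : σ →₀ ℕ) l = 1 :=
      fun k => Finset.prod_eq_one fun l hl => by
        rw [Finsupp.single_apply, if_neg (Finset.ne_of_mem_erase hl).symm, pow_zero]
    have hmon1 : ∏ l, z l ^ (Finsupp.single j 1 : σ →₀ ℕ) l = w := by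
      rw [← Finset.mul_prod_erase Finset.univ _ (Finset.mem_univ j), Finsupp.single_eq_same, pow_one, hzj,
        hone j, mul_one]
    have hmon2 : ∏ l, z l ^ (Finsupp.single i 1 + Finsupp.single j 1 : σ →₀ ℕ) l = Complex.I * w := by
      simp only [Finsupp.add_apply, pow_add, Finset.prod_mul_distrib]
      rw [hmon1, ← Finset.mul_prod_erase Finset.univ _ (Finset.mem_univ i), Finsupp.single_eq_same, pow_one,
        hzi, hone i, mul_one]
    have key : (B : ℂ) * w + (C : ℂ) * (Complex.I * w) = -A := by
      rw [show (B : ℂ) * w + (C : ℂ) * (Complex.I * w) = w * ((B : ℂ) + (C : ℂ) * Complex.I) by ring, hw,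
        div_mul_cancel₀ _ hden]
    rw [eval_eq_sum_of_support_subset hS, Finset.sum_insert h0ne, Finset.sum_insert h1ne, Finset.sum_singleton,
      ha, hb, hc, hmon0, hmon1, hmon2]
    linear_combination s * key

/-- **Brändén 2007, Corollary 3.7: "Let `f` be a real stable polynomial with nonnegative coefficients. If
`α ≤ γ ≤ β` and `α, β ∈ supp(f)`, then `γ ∈ supp(f)`."** (No internal zeros; by `coeff_add_single_ne_zero`,
walking up from `α` to `γ` one unit step at a time.) [cite: Branden2007, §3 Cor. 3.7] -/
theorem IsRealStable.coeff_ne_zero_of_le_of_le {f : MvPolynomial σ ℝ} (hf : IsRealStable f)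
    (hnn : ∀ m, 0 ≤ coeff m f) {α β γ : σ →₀ ℕ} (hα : coeff α f ≠ 0) (hβ : coeff β f ≠ 0) (hαγ : α ≤ γ)
    (hγβ : γ ≤ β) : coeff γ f ≠ 0 := by
  suffices H : ∀ (N : ℕ) (α : σ →₀ ℕ), (γ - α).degree = N → coeff α f ≠ 0 → α ≤ γ → coeff γ f ≠ 0 from
    H _ α rfl hα hαγ
  intro N
  induction N with
  | zero =>
    intro α hN hα hαγ
    have : γ - α = 0 := (Finsupp.degree_eq_zero_iff _).1 hN
    rwa [← tsub_add_cancel_of_le hαγ, this, zero_add]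
  | succ N ih =>
    intro α hN hα hαγ
    have hne : γ - α ≠ 0 := fun h => by
      rw [h, map_zero] at hN
      exact Nat.succ_ne_zero N hN.symm
    obtain ⟨i, hi⟩ := Finsupp.ne_iff.1 hne
    have hi' : α i < γ i := by
      rw [Finsupp.tsub_apply, Finsupp.coe_zero, Pi.zero_apply] at hi
      omega
    have hstep := hf.coeff_add_single_ne_zero hnn (hαγ.trans hγβ) hα hβ
      (lt_of_lt_of_le hi' (Finsupp.le_def.1 hγβ i))
    refine ih (α + Finsupp.single i 1) ?_ hstep (Finsupp.le_def.2 fun l => ?_)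
    · have h1 : γ - α = γ - (α + Finsupp.single i 1) + Finsupp.single i 1 := by
        ext l
        rw [Finsupp.add_apply, Finsupp.tsub_apply, Finsupp.tsub_apply, Finsupp.add_apply,
          Finsupp.single_apply]
        have := Finsupp.le_def.1 hαγ l
        split_ifs with h
        · subst h
          omega
        · omega
      rw [h1, map_add, Finsupp.degree_single] at hN
      omega
    · rw [Finsupp.add_apply, Finsupp.single_apply]
      have := Finsupp.le_def.1 hαγ l
      split_ifs with h
      · subst h
        omega
      · omega

end NoInternalZeros

end Literature.Combinatorics.StablePolynomials

end
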